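import Literature.Computability.Complexity.SuccinctKernelVectorGates
import HarnessLib

/-!
# The succinct kernel-vector circuit, II: the `SuccCircuit` axioms and the circuit (val-lit KV20 M1
# programme, step (P6), file B1b)

Sequel of `SuccinctKernelVectorGates.lean` (the 31-tag gate vocabulary of the kernel-vector circuit
of an integer matrix family `Φ : SuccIntMatrixFamily`, as fixed arithmetic expressions on padded
tuple names, with the per-tag evaluation lemmas). Here: for EVERY string, the children of a gate
fit in the name and are strictly shallower (`step_all`, by the per-tag `step_*` lemmas), the depth
is linearly bounded in the name length (`dle_all`), the constant bits are polynomial time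
(`codeFP_cbitF`); whence ★ `KVC.kvc Φ : SuccCircuit` (p1 g9's structure, `SuccinctCircuitBits.lean`)
— the circuit whose designated gates `V(s, r)` will be shown, in `SuccinctKernelVectorValues.lean`,
to carry the positive and negative parts of the entries of `charpolyKernelVector (A_nᵀ A_n)`.

HONEST FRAMING (val-lit, KV20 M1 programme, RULING (120)): Boolean/arithmetic plumbing; proves
nothing about `kumarVolk2020_cor_1_3` by itself (census +0); `VP ≠ VNP` is NOT proved.

## References

* P. Koiran, S. Perifel, *VPSPACE and a transfer theorem over the reals*, Comput. Complexity 18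
  (2009), §3.2 (Uniform `VPAR⁰`; Prop. 1) [KoiranPerifel2009VPSPACE].
* M. Mahajan, V. Vinay, *Determinant: old algorithms, new insights*, SIAM J. Discrete Math. 12
  (1999), Thm. 3.2 and §3.1 [MahajanVinay1999].
* A. Borodin, J. von zur Gathen, J. Hopcroft, Inform. and Control 52 (1982), §5 [BorodinVonzurgathenHopcroft1982].
* M. Kumar, B. L. Volk, ACM TOCT 14 (2022), §6 (proof of Cor. 1.3) [KumarVolk2022].
* S. Arora, B. Barak, *Computational Complexity*, CUP 2009, §1.3 [AroraBarak2009].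
-/

noncomputable section

namespace Literature.Computability.Complexity

open _root_.Computability CodeFP Brick Finset CodeFP.AExp

namespace KVC

open SuccCircuit

variable (Φ : SuccIntMatrixFamily)

section SyntaxTags
variable {n len s f1 f2 f3 f4 f5 f6 : ℕ}

/-- `ONE` has no children. [cite: KoiranPerifel2009VPSPACE, §3.2] -/
theorem step_ONE (h : WF Φ n len [0, s, f1, f2, f3, f4, f5, f6]) (k : ℕ)
    (hk : k < gateFanIn (kindX.eval (aenv Φ.params n len [0, s, f1, f2, f3, f4, f5, f6])) (arityX.eval (aenv Φ.params n len [0, s, f1, f2, f3, f4, f5, f6]))) :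
    (gcore n (childX.map (AExp.eval (aenvK Φ.params n len [0, s, f1, f2, f3, f4, f5, f6] k)))).length ≤ len ∧
    WF Φ n len (childX.map (AExp.eval (aenvK Φ.params n len [0, s, f1, f2, f3, f4, f5, f6] k))) ∧
    depthX.eval (aenv Φ.params n len (childX.map (AExp.eval (aenvK Φ.params n len [0, s, f1, f2, f3, f4, f5, f6] k)))) <
      depthX.eval (aenv Φ.params n len [0, s, f1, f2, f3, f4, f5, f6]) := by
  exfalso; rw [kind_ONE Φ h] at hk; simp [gateFanIn] at hk

/-- `A` has no children. [cite: KoiranPerifel2009VPSPACE, §3.2] -/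
theorem step_A (h : WF Φ n len [1, s, f1, f2, f3, f4, f5, f6]) (k : ℕ)
    (hk : k < gateFanIn (kindX.eval (aenv Φ.params n len [1, s, f1, f2, f3, f4, f5, f6])) (arityX.eval (aenv Φ.params n len [1, s, f1, f2, f3, f4, f5, f6]))) :
    (gcore n (childX.map (AExp.eval (aenvK Φ.params n len [1, s, f1, f2, f3, f4, f5, f6] k)))).length ≤ len ∧
    WF Φ n len (childX.map (AExp.eval (aenvK Φ.params n len [1, s, f1, f2, f3, f4, f5, f6] k))) ∧
    depthX.eval (aenv Φ.params n len (childX.map (AExp.eval (aenvK Φ.params n len [1, s, f1, f2, f3, f4, f5, f6] k)))) <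
      depthX.eval (aenv Φ.params n len [1, s, f1, f2, f3, f4, f5, f6]) := by
  exfalso; rw [kind_A Φ h] at hk; simp [gateFanIn] at hk

/-- Children of `B`: they fit, and they are shallower. [cite: KoiranPerifel2009VPSPACE, §3.2] -/
theorem step_B (h : WF Φ n len [2, s, f1, f2, f3, f4, f5, f6]) (k : ℕ)
    (hk : k < gateFanIn (kindX.eval (aenv Φ.params n len [2, s, f1, f2, f3, f4, f5, f6])) (arityX.eval (aenv Φ.params n len [2, s, f1, f2, f3, f4, f5, f6]))) :
    (gcore n (childX.map (AExp.eval (aenvK Φ.params n len [2, s, f1, f2, f3, f4, f5, f6] k)))).length ≤ len ∧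
    WF Φ n len (childX.map (AExp.eval (aenvK Φ.params n len [2, s, f1, f2, f3, f4, f5, f6] k))) ∧
    depthX.eval (aenv Φ.params n len (childX.map (AExp.eval (aenvK Φ.params n len [2, s, f1, f2, f3, f4, f5, f6] k)))) <
      depthX.eval (aenv Φ.params n len [2, s, f1, f2, f3, f4, f5, f6]) := by
  obtain ⟨hFB, h2X, h2R, h2NN, h2N1, hXeq, hTF, hTFB, hLreq⟩ := Φ.param_facts n
  obtain ⟨⟨h30, hs, hb1, hb2, hb3, hb4, hb5, hb6, hlen, hNpos⟩, hr⟩ := (wf_B Φ).1 h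
  obtain ⟨hr1, hr2⟩ := hr
  rw [kind_B Φ h, arity_B Φ h] at hk
  simp only [gateFanIn] at hk; norm_num at hk
  rw [child_B, depth_B Φ h]
  have hw' := (wf_PA Φ (n := n) (len := len) (s := s) (f1 := f1) (f2 := f2) (f3 := k) (f4 := 0) (f5 := 0) (f6 := 0)).2 ⟨⟨by omega, by omega, by omega, by omega, by omega, by omega, by omega, by omega, hlen, hNpos⟩, ⟨by omega, by omega, by omega⟩⟩
  refine ⟨fits8 Φ (by omega) (by omega) (by omega) (by omega) (by omega) (by omega) (by omega) (by omega) hlen, hw', ?_⟩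
  rw [depth_PA Φ hw']
  omega

/-- Children of `PA`: they fit, and they are shallower. [cite: KoiranPerifel2009VPSPACE, §3.2] -/
theorem step_PA (h : WF Φ n len [3, s, f1, f2, f3, f4, f5, f6]) (k : ℕ)
    (hk : k < gateFanIn (kindX.eval (aenv Φ.params n len [3, s, f1, f2, f3, f4, f5, f6])) (arityX.eval (aenv Φ.params n len [3, s, f1, f2, f3, f4, f5, f6]))) :
    (gcore n (childX.map (AExp.eval (aenvK Φ.params n len [3, s, f1, f2, f3, f4, f5, f6] k)))).length ≤ len ∧
    WF Φ n len (childX.map (AExp.eval (aenvK Φ.params n len [3, s, f1, f2, f3, f4, f5, f6] k))) ∧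
    depthX.eval (aenv Φ.params n len (childX.map (AExp.eval (aenvK Φ.params n len [3, s, f1, f2, f3, f4, f5, f6] k)))) <
      depthX.eval (aenv Φ.params n len [3, s, f1, f2, f3, f4, f5, f6]) := by
  obtain ⟨hFB, h2X, h2R, h2NN, h2N1, hXeq, hTF, hTFB, hLreq⟩ := Φ.param_facts n
  obtain ⟨⟨h30, hs, hb1, hb2, hb3, hb4, hb5, hb6, hlen, hNpos⟩, hr⟩ := (wf_PA Φ).1 h
  obtain ⟨hr1, hr2, hr3⟩ := hr
  rw [kind_PA Φ h] at hk
  simp only [gateFanIn] at hk; norm_num at hk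
  interval_cases k
  · rw [child_PA_0, depth_PA Φ h]
    have hw' := (wf_A Φ (n := n) (len := len) (s := (f3 % 2)) (f1 := (f3 / 2)) (f2 := f1) (f3 := 0) (f4 := 0) (f5 := 0) (f6 := 0)).2 ⟨⟨by omega, by omega, by omega, by omega, by omega, by omega, by omega, by omega, hlen, hNpos⟩, ⟨by omega, by omega⟩⟩
    refine ⟨fits8 Φ (by omega) (by omega) (by omega) (by omega) (by omega) (by omega) (by omega) (by omega) hlen, hw', ?_⟩
    rw [depth_A Φ hw']
    omega
  · rw [child_PA_1, depth_PA Φ h]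
    have hw' := (wf_A Φ (n := n) (len := len) (s := (((f3 % 2) + s) % 2)) (f1 := (f3 / 2)) (f2 := f2) (f3 := 0) (f4 := 0) (f5 := 0) (f6 := 0)).2 ⟨⟨by omega, by omega, by omega, by omega, by omega, by omega, by omega, by omega, hlen, hNpos⟩, ⟨by omega, by omega⟩⟩
    refine ⟨fits8 Φ (by omega) (by omega) (by omega) (by omega) (by omega) (by omega) (by omega) (by omega) hlen, hw', ?_⟩
    rw [depth_A Φ hw']
    omega

/-- Children of `PP`: they fit, and they are shallower. [cite: KoiranPerifel2009VPSPACE, §3.2] -/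
theorem step_PP (h : WF Φ n len [6, s, f1, f2, f3, f4, f5, f6]) (k : ℕ)
    (hk : k < gateFanIn (kindX.eval (aenv Φ.params n len [6, s, f1, f2, f3, f4, f5, f6])) (arityX.eval (aenv Φ.params n len [6, s, f1, f2, f3, f4, f5, f6]))) :
    (gcore n (childX.map (AExp.eval (aenvK Φ.params n len [6, s, f1, f2, f3, f4, f5, f6] k)))).length ≤ len ∧
    WF Φ n len (childX.map (AExp.eval (aenvK Φ.params n len [6, s, f1, f2, f3, f4, f5, f6] k))) ∧
    depthX.eval (aenv Φ.params n len (childX.map (AExp.eval (aenvK Φ.params n len [6, s, f1, f2, f3, f4, f5, f6] k)))) <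
      depthX.eval (aenv Φ.params n len [6, s, f1, f2, f3, f4, f5, f6]) := by
  obtain ⟨hFB, h2X, h2R, h2NN, h2N1, hXeq, hTF, hTFB, hLreq⟩ := Φ.param_facts n
  obtain ⟨⟨h30, hs, hb1, hb2, hb3, hb4, hb5, hb6, hlen, hNpos⟩, hr⟩ := (wf_PP Φ).1 h
  obtain ⟨hr1, hr2, hr3, hr4, hr5⟩ := hr
  rw [kind_PP Φ h] at hk
  simp only [gateFanIn] at hk; norm_num at hk
  interval_cases k
  · rw [child_PP_0, depth_PP Φ h]
    have hw' := (wf_P Φ (n := n) (len := len) (s := (f4 % 2)) (f1 := (f1 - 1)) (f2 := f2) (f3 := (f4 / 2)) (f4 := 0) (f5 := 0) (f6 := 0)).2 ⟨⟨by omega, by omega, by omega, by omega, by omega, by omega, by omega, by omega, hlen, hNpos⟩, ⟨by omega, by omega, by omega⟩⟩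
    refine ⟨fits8 Φ (by omega) (by omega) (by omega) (by omega) (by omega) (by omega) (by omega) (by omega) hlen, hw', ?_⟩
    rw [depth_P Φ hw']
    omega
  · rw [child_PP_1, depth_PP Φ h]
    have hw' := (wf_P Φ (n := n) (len := len) (s := (((f4 % 2) + s) % 2)) (f1 := (f1 - 1)) (f2 := (f4 / 2)) (f3 := f3) (f4 := 0) (f5 := 0) (f6 := 0)).2 ⟨⟨by omega, by omega, by omega, by omega, by omega, by omega, by omega, by omega, hlen, hNpos⟩, ⟨by omega, by omega, by omega⟩⟩
    refine ⟨fits8 Φ (by omega) (by omega) (by omega) (by omega) (by omega) (by omega) (by omega) (by omega) hlen, hw', ?_⟩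
    rw [depth_P Φ hw']
    omega

/-- Children of `C`: they fit, and they are shallower. [cite: KoiranPerifel2009VPSPACE, §3.2] -/
theorem step_C (h : WF Φ n len [7, s, f1, f2, f3, f4, f5, f6]) (k : ℕ)
    (_hk : k < gateFanIn (kindX.eval (aenv Φ.params n len [7, s, f1, f2, f3, f4, f5, f6])) (arityX.eval (aenv Φ.params n len [7, s, f1, f2, f3, f4, f5, f6]))) :
    (gcore n (childX.map (AExp.eval (aenvK Φ.params n len [7, s, f1, f2, f3, f4, f5, f6] k)))).length ≤ len ∧
    WF Φ n len (childX.map (AExp.eval (aenvK Φ.params n len [7, s, f1, f2, f3, f4, f5, f6] k))) ∧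
    depthX.eval (aenv Φ.params n len (childX.map (AExp.eval (aenvK Φ.params n len [7, s, f1, f2, f3, f4, f5, f6] k)))) <
      depthX.eval (aenv Φ.params n len [7, s, f1, f2, f3, f4, f5, f6]) := by
  obtain ⟨hFB, h2X, h2R, h2NN, h2N1, hXeq, hTF, hTFB, hLreq⟩ := Φ.param_facts n
  obtain ⟨⟨h30, hs, hb1, hb2, hb3, hb4, hb5, hb6, hlen, hNpos⟩, hr⟩ := (wf_C Φ).1 h
  have hr1 := hr
  rw [child_C, depth_C Φ h]
  have hw' := (wf_P Φ (n := n) (len := len) (s := s) (f1 := (Φ.T n)) (f2 := 0) (f3 := ((1 + (Φ.Lmid n)) + ((Φ.N n) - f1))) (f4 := 0) (f5 := 0) (f6 := 0)).2 ⟨⟨by omega, by omega, by omega, by omega, by omega, by omega, by omega, by omega, hlen, hNpos⟩, ⟨by omega, by omega, by omega⟩⟩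
  refine ⟨fits8 Φ (by omega) (by omega) (by omega) (by omega) (by omega) (by omega) (by omega) (by omega) hlen, hw', ?_⟩
  rw [depth_P Φ hw']
  omega

/-- Children of `SQ`: they fit, and they are shallower. [cite: KoiranPerifel2009VPSPACE, §3.2] -/
theorem step_SQ (h : WF Φ n len [9, s, f1, f2, f3, f4, f5, f6]) (k : ℕ)
    (hk : k < gateFanIn (kindX.eval (aenv Φ.params n len [9, s, f1, f2, f3, f4, f5, f6])) (arityX.eval (aenv Φ.params n len [9, s, f1, f2, f3, f4, f5, f6]))) :
    (gcore n (childX.map (AExp.eval (aenvK Φ.params n len [9, s, f1, f2, f3, f4, f5, f6] k)))).length ≤ len ∧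
    WF Φ n len (childX.map (AExp.eval (aenvK Φ.params n len [9, s, f1, f2, f3, f4, f5, f6] k))) ∧
    depthX.eval (aenv Φ.params n len (childX.map (AExp.eval (aenvK Φ.params n len [9, s, f1, f2, f3, f4, f5, f6] k)))) <
      depthX.eval (aenv Φ.params n len [9, s, f1, f2, f3, f4, f5, f6]) := by
  obtain ⟨hFB, h2X, h2R, h2NN, h2N1, hXeq, hTF, hTFB, hLreq⟩ := Φ.param_facts n
  obtain ⟨⟨h30, hs, hb1, hb2, hb3, hb4, hb5, hb6, hlen, hNpos⟩, hr⟩ := (wf_SQ Φ).1 h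
  obtain ⟨hr1, hr2, hr3, hr4⟩ := hr
  rw [kind_SQ Φ h, arity_SQ Φ h] at hk
  simp only [gateFanIn] at hk; norm_num at hk
  rw [child_SQ, depth_SQ Φ h]
  have hw' := (wf_PSQ Φ (n := n) (len := len) (s := s) (f1 := f1) (f2 := f2) (f3 := f3) (f4 := k) (f5 := 0) (f6 := 0)).2 ⟨⟨by omega, by omega, by omega, by omega, by omega, by omega, by omega, by omega, hlen, hNpos⟩, ⟨by omega, by omega, by omega, by omega, by omega⟩⟩
  refine ⟨fits8 Φ (by omega) (by omega) (by omega) (by omega) (by omega) (by omega) (by omega) (by omega) hlen, hw', ?_⟩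
  rw [depth_PSQ Φ hw']
  omega

/-- Children of `PSQ`: they fit, and they are shallower. [cite: KoiranPerifel2009VPSPACE, §3.2] -/
theorem step_PSQ (h : WF Φ n len [10, s, f1, f2, f3, f4, f5, f6]) (k : ℕ)
    (hk : k < gateFanIn (kindX.eval (aenv Φ.params n len [10, s, f1, f2, f3, f4, f5, f6])) (arityX.eval (aenv Φ.params n len [10, s, f1, f2, f3, f4, f5, f6]))) :
    (gcore n (childX.map (AExp.eval (aenvK Φ.params n len [10, s, f1, f2, f3, f4, f5, f6] k)))).length ≤ len ∧
    WF Φ n len (childX.map (AExp.eval (aenvK Φ.params n len [10, s, f1, f2, f3, f4, f5, f6] k))) ∧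
    depthX.eval (aenv Φ.params n len (childX.map (AExp.eval (aenvK Φ.params n len [10, s, f1, f2, f3, f4, f5, f6] k)))) <
      depthX.eval (aenv Φ.params n len [10, s, f1, f2, f3, f4, f5, f6]) := by
  obtain ⟨hFB, h2X, h2R, h2NN, h2N1, hXeq, hTF, hTFB, hLreq⟩ := Φ.param_facts n
  obtain ⟨⟨h30, hs, hb1, hb2, hb3, hb4, hb5, hb6, hlen, hNpos⟩, hr⟩ := (wf_PSQ Φ).1 h
  obtain ⟨hr1, hr2, hr3, hr4, hr5⟩ := hr
  rw [kind_PSQ Φ h] at hk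
  simp only [gateFanIn] at hk; norm_num at hk
  have hsz := size_div_two hr1
  interval_cases k
  · rw [child_PSQ_0, depth_PSQ Φ h]
    have hw' := (wf_BP Φ (n := n) (len := len) (s := (f4 % 2)) (f1 := (f1 / 2)) (f2 := f2) (f3 := (f4 / 2)) (f4 := 0) (f5 := 0) (f6 := 0)).2 ⟨⟨by omega, by omega, by omega, by omega, by omega, by omega, by omega, by omega, hlen, hNpos⟩, ⟨by omega, by omega, by omega⟩⟩
    refine ⟨fits8 Φ (by omega) (by omega) (by omega) (by omega) (by omega) (by omega) (by omega) (by omega) hlen, hw', ?_⟩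
    rw [depth_BP Φ hw']
    omega
  · rw [child_PSQ_1, depth_PSQ Φ h]
    have hw' := (wf_BP Φ (n := n) (len := len) (s := (((f4 % 2) + s) % 2)) (f1 := (f1 / 2)) (f2 := (f4 / 2)) (f3 := f3) (f4 := 0) (f5 := 0) (f6 := 0)).2 ⟨⟨by omega, by omega, by omega, by omega, by omega, by omega, by omega, by omega, hlen, hNpos⟩, ⟨by omega, by omega, by omega⟩⟩
    refine ⟨fits8 Φ (by omega) (by omega) (by omega) (by omega) (by omega) (by omega) (by omega) (by omega) hlen, hw', ?_⟩
    rw [depth_BP Φ hw']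
    omega

/-- Children of `PBP`: they fit, and they are shallower. [cite: KoiranPerifel2009VPSPACE, §3.2] -/
theorem step_PBP (h : WF Φ n len [11, s, f1, f2, f3, f4, f5, f6]) (k : ℕ)
    (hk : k < gateFanIn (kindX.eval (aenv Φ.params n len [11, s, f1, f2, f3, f4, f5, f6])) (arityX.eval (aenv Φ.params n len [11, s, f1, f2, f3, f4, f5, f6]))) :
    (gcore n (childX.map (AExp.eval (aenvK Φ.params n len [11, s, f1, f2, f3, f4, f5, f6] k)))).length ≤ len ∧
    WF Φ n len (childX.map (AExp.eval (aenvK Φ.params n len [11, s, f1, f2, f3, f4, f5, f6] k))) ∧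
    depthX.eval (aenv Φ.params n len (childX.map (AExp.eval (aenvK Φ.params n len [11, s, f1, f2, f3, f4, f5, f6] k)))) <
      depthX.eval (aenv Φ.params n len [11, s, f1, f2, f3, f4, f5, f6]) := by
  obtain ⟨hFB, h2X, h2R, h2NN, h2N1, hXeq, hTF, hTFB, hLreq⟩ := Φ.param_facts n
  obtain ⟨⟨h30, hs, hb1, hb2, hb3, hb4, hb5, hb6, hlen, hNpos⟩, hr⟩ := (wf_PBP Φ).1 h
  obtain ⟨hr1, hr2, hr3, hr4, hr5, hr6⟩ := hr
  rw [kind_PBP Φ h] at hk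
  simp only [gateFanIn] at hk; norm_num at hk
  have hsz : 0 < Nat.size f1 := Nat.size_pos.2 hr1
  interval_cases k
  · rw [child_PBP_0, depth_PBP Φ h]
    have hw' := (wf_SQ Φ (n := n) (len := len) (s := (f4 % 2)) (f1 := f1) (f2 := f2) (f3 := (f4 / 2)) (f4 := 0) (f5 := 0) (f6 := 0)).2 ⟨⟨by omega, by omega, by omega, by omega, by omega, by omega, by omega, by omega, hlen, hNpos⟩, ⟨by omega, by omega, by omega, by omega⟩⟩
    refine ⟨fits8 Φ (by omega) (by omega) (by omega) (by omega) (by omega) (by omega) (by omega) (by omega) hlen, hw', ?_⟩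
    rw [depth_SQ Φ hw']
    omega
  · rw [child_PBP_1, depth_PBP Φ h]
    have hw' := (wf_B Φ (n := n) (len := len) (s := (((f4 % 2) + s) % 2)) (f1 := (f4 / 2)) (f2 := f3) (f3 := 0) (f4 := 0) (f5 := 0) (f6 := 0)).2 ⟨⟨by omega, by omega, by omega, by omega, by omega, by omega, by omega, by omega, hlen, hNpos⟩, ⟨by omega, by omega⟩⟩
    refine ⟨fits8 Φ (by omega) (by omega) (by omega) (by omega) (by omega) (by omega) (by omega) (by omega) hlen, hw', ?_⟩
    rw [depth_B Φ hw']
    omega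

/-- Children of `CSQ`: they fit, and they are shallower. [cite: KoiranPerifel2009VPSPACE, §3.2] -/
theorem step_CSQ (h : WF Φ n len [12, s, f1, f2, f3, f4, f5, f6]) (k : ℕ)
    (hk : k < gateFanIn (kindX.eval (aenv Φ.params n len [12, s, f1, f2, f3, f4, f5, f6])) (arityX.eval (aenv Φ.params n len [12, s, f1, f2, f3, f4, f5, f6]))) :
    (gcore n (childX.map (AExp.eval (aenvK Φ.params n len [12, s, f1, f2, f3, f4, f5, f6] k)))).length ≤ len ∧
    WF Φ n len (childX.map (AExp.eval (aenvK Φ.params n len [12, s, f1, f2, f3, f4, f5, f6] k))) ∧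
    depthX.eval (aenv Φ.params n len (childX.map (AExp.eval (aenvK Φ.params n len [12, s, f1, f2, f3, f4, f5, f6] k)))) <
      depthX.eval (aenv Φ.params n len [12, s, f1, f2, f3, f4, f5, f6]) := by
  obtain ⟨hFB, h2X, h2R, h2NN, h2N1, hXeq, hTF, hTFB, hLreq⟩ := Φ.param_facts n
  obtain ⟨⟨h30, hs, hb1, hb2, hb3, hb4, hb5, hb6, hlen, hNpos⟩, hr⟩ := (wf_CSQ Φ).1 h
  have hr1 := hr
  rw [kind_CSQ Φ h, arity_CSQ Φ h] at hk
  simp only [gateFanIn] at hk; norm_num at hk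
  rw [child_CSQ, depth_CSQ Φ h]
  have hw' := (wf_PC Φ (n := n) (len := len) (s := s) (f1 := k) (f2 := 0) (f3 := 0) (f4 := 0) (f5 := 0) (f6 := 0)).2 ⟨⟨by omega, by omega, by omega, by omega, by omega, by omega, by omega, by omega, hlen, hNpos⟩, by omega⟩
  refine ⟨fits8 Φ (by omega) (by omega) (by omega) (by omega) (by omega) (by omega) (by omega) (by omega) hlen, hw', ?_⟩
  rw [depth_PC Φ hw']
  omega

/-- Children of `PC`: they fit, and they are shallower. [cite: KoiranPerifel2009VPSPACE, §3.2] -/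
theorem step_PC (h : WF Φ n len [13, s, f1, f2, f3, f4, f5, f6]) (k : ℕ)
    (hk : k < gateFanIn (kindX.eval (aenv Φ.params n len [13, s, f1, f2, f3, f4, f5, f6])) (arityX.eval (aenv Φ.params n len [13, s, f1, f2, f3, f4, f5, f6]))) :
    (gcore n (childX.map (AExp.eval (aenvK Φ.params n len [13, s, f1, f2, f3, f4, f5, f6] k)))).length ≤ len ∧
    WF Φ n len (childX.map (AExp.eval (aenvK Φ.params n len [13, s, f1, f2, f3, f4, f5, f6] k))) ∧
    depthX.eval (aenv Φ.params n len (childX.map (AExp.eval (aenvK Φ.params n len [13, s, f1, f2, f3, f4, f5, f6] k)))) <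
      depthX.eval (aenv Φ.params n len [13, s, f1, f2, f3, f4, f5, f6]) := by
  obtain ⟨hFB, h2X, h2R, h2NN, h2N1, hXeq, hTF, hTFB, hLreq⟩ := Φ.param_facts n
  obtain ⟨⟨h30, hs, hb1, hb2, hb3, hb4, hb5, hb6, hlen, hNpos⟩, hr⟩ := (wf_PC Φ).1 h
  have hr1 := hr
  rw [kind_PC Φ h] at hk
  simp only [gateFanIn] at hk; norm_num at hk
  interval_cases k
  · rw [child_PC_0, depth_PC Φ h]
    have hw' := (wf_C Φ (n := n) (len := len) (s := (f1 % 2)) (f1 := (f1 / 2)) (f2 := 0) (f3 := 0) (f4 := 0) (f5 := 0) (f6 := 0)).2 ⟨⟨by omega, by omega, by omega, by omega, by omega, by omega, by omega, by omega, hlen, hNpos⟩, by omega⟩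
    refine ⟨fits8 Φ (by omega) (by omega) (by omega) (by omega) (by omega) (by omega) (by omega) (by omega) hlen, hw', ?_⟩
    rw [depth_C Φ hw']
    omega
  · rw [child_PC_1, depth_PC Φ h]
    have hw' := (wf_C Φ (n := n) (len := len) (s := (((f1 % 2) + s) % 2)) (f1 := (f1 / 2)) (f2 := 0) (f3 := 0) (f4 := 0) (f5 := 0) (f6 := 0)).2 ⟨⟨by omega, by omega, by omega, by omega, by omega, by omega, by omega, by omega, hlen, hNpos⟩, by omega⟩
    refine ⟨fits8 Φ (by omega) (by omega) (by omega) (by omega) (by omega) (by omega) (by omega) (by omega) hlen, hw', ?_⟩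
    rw [depth_C Φ hw']
    omega

/-- Children of `QK`: they fit, and they are shallower. [cite: KoiranPerifel2009VPSPACE, §3.2] -/
theorem step_QK (h : WF Φ n len [14, s, f1, f2, f3, f4, f5, f6]) (k : ℕ)
    (hk : k < gateFanIn (kindX.eval (aenv Φ.params n len [14, s, f1, f2, f3, f4, f5, f6])) (arityX.eval (aenv Φ.params n len [14, s, f1, f2, f3, f4, f5, f6]))) :
    (gcore n (childX.map (AExp.eval (aenvK Φ.params n len [14, s, f1, f2, f3, f4, f5, f6] k)))).length ≤ len ∧
    WF Φ n len (childX.map (AExp.eval (aenvK Φ.params n len [14, s, f1, f2, f3, f4, f5, f6] k))) ∧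
    depthX.eval (aenv Φ.params n len (childX.map (AExp.eval (aenvK Φ.params n len [14, s, f1, f2, f3, f4, f5, f6] k)))) <
      depthX.eval (aenv Φ.params n len [14, s, f1, f2, f3, f4, f5, f6]) := by
  obtain ⟨hFB, h2X, h2R, h2NN, h2N1, hXeq, hTF, hTFB, hLreq⟩ := Φ.param_facts n
  obtain ⟨⟨h30, hs, hb1, hb2, hb3, hb4, hb5, hb6, hlen, hNpos⟩, hr⟩ := (wf_QK Φ).1 h
  obtain ⟨hr1, hr2, hr3, hr4⟩ := hr
  rw [kind_QK Φ h, arity_QK Φ h] at hk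
  simp only [gateFanIn] at hk; norm_num at hk
  rw [child_QK, depth_QK Φ h]
  have hw' := (wf_PQK Φ (n := n) (len := len) (s := s) (f1 := f1) (f2 := f2) (f3 := f3) (f4 := f4) (f5 := k) (f6 := 0)).2 ⟨⟨by omega, by omega, by omega, by omega, by omega, by omega, by omega, by omega, hlen, hNpos⟩, ⟨by omega, by omega, by omega, by omega, by omega⟩⟩
  refine ⟨fits8 Φ (by omega) (by omega) (by omega) (by omega) (by omega) (by omega) (by omega) (by omega) hlen, hw', ?_⟩
  rw [depth_PQK Φ hw']
  omega

/-- Children of `PQK`: they fit, and they are shallower. [cite: KoiranPerifel2009VPSPACE, §3.2] -/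
theorem step_PQK (h : WF Φ n len [15, s, f1, f2, f3, f4, f5, f6]) (k : ℕ)
    (hk : k < gateFanIn (kindX.eval (aenv Φ.params n len [15, s, f1, f2, f3, f4, f5, f6])) (arityX.eval (aenv Φ.params n len [15, s, f1, f2, f3, f4, f5, f6]))) :
    (gcore n (childX.map (AExp.eval (aenvK Φ.params n len [15, s, f1, f2, f3, f4, f5, f6] k)))).length ≤ len ∧
    WF Φ n len (childX.map (AExp.eval (aenvK Φ.params n len [15, s, f1, f2, f3, f4, f5, f6] k))) ∧
    depthX.eval (aenv Φ.params n len (childX.map (AExp.eval (aenvK Φ.params n len [15, s, f1, f2, f3, f4, f5, f6] k)))) <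
      depthX.eval (aenv Φ.params n len [15, s, f1, f2, f3, f4, f5, f6]) := by
  obtain ⟨hFB, h2X, h2R, h2NN, h2N1, hXeq, hTF, hTFB, hLreq⟩ := Φ.param_facts n
  obtain ⟨⟨h30, hs, hb1, hb2, hb3, hb4, hb5, hb6, hlen, hNpos⟩, hr⟩ := (wf_PQK Φ).1 h
  obtain ⟨hr1, hr2, hr3, hr4, hr5⟩ := hr
  rw [kind_PQK Φ h] at hk
  simp only [gateFanIn] at hk; norm_num at hk
  have hszs : Nat.size (f5 / 2 + f2) ≤ Φ.F n + 1 := Φ.size_le_of_le_two_N (by omega)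
  interval_cases k
  · rw [child_PQK_0, depth_PQK Φ h]
    have hw' := (wf_C Φ (n := n) (len := len) (s := (f5 % 2)) (f1 := ((f5 / 2) + f1)) (f2 := 0) (f3 := 0) (f4 := 0) (f5 := 0) (f6 := 0)).2 ⟨⟨by omega, by omega, by omega, by omega, by omega, by omega, by omega, by omega, hlen, hNpos⟩, by omega⟩
    refine ⟨fits8 Φ (by omega) (by omega) (by omega) (by omega) (by omega) (by omega) (by omega) (by omega) hlen, hw', ?_⟩
    rw [depth_C Φ hw']
    omega
  · rw [child_PQK_1, depth_PQK Φ h]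
    have hw' := (wf_BP Φ (n := n) (len := len) (s := (((f5 % 2) + s) % 2)) (f1 := ((f5 / 2) + f2)) (f2 := f3) (f3 := f4) (f4 := 0) (f5 := 0) (f6 := 0)).2 ⟨⟨by omega, by omega, by omega, by omega, by omega, by omega, by omega, by omega, hlen, hNpos⟩, ⟨by omega, by omega, by omega⟩⟩
    refine ⟨fits8 Φ (by omega) (by omega) (by omega) (by omega) (by omega) (by omega) (by omega) (by omega) hlen, hw', ?_⟩
    rw [depth_BP Φ hw']
    omega

/-- Children of `QT`: they fit, and they are shallower. [cite: KoiranPerifel2009VPSPACE, §3.2] -/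
theorem step_QT (h : WF Φ n len [16, s, f1, f2, f3, f4, f5, f6]) (k : ℕ)
    (hk : k < gateFanIn (kindX.eval (aenv Φ.params n len [16, s, f1, f2, f3, f4, f5, f6])) (arityX.eval (aenv Φ.params n len [16, s, f1, f2, f3, f4, f5, f6]))) :
    (gcore n (childX.map (AExp.eval (aenvK Φ.params n len [16, s, f1, f2, f3, f4, f5, f6] k)))).length ≤ len ∧
    WF Φ n len (childX.map (AExp.eval (aenvK Φ.params n len [16, s, f1, f2, f3, f4, f5, f6] k))) ∧
    depthX.eval (aenv Φ.params n len (childX.map (AExp.eval (aenvK Φ.params n len [16, s, f1, f2, f3, f4, f5, f6] k)))) <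
      depthX.eval (aenv Φ.params n len [16, s, f1, f2, f3, f4, f5, f6]) := by
  obtain ⟨hFB, h2X, h2R, h2NN, h2N1, hXeq, hTF, hTFB, hLreq⟩ := Φ.param_facts n
  obtain ⟨⟨h30, hs, hb1, hb2, hb3, hb4, hb5, hb6, hlen, hNpos⟩, hr⟩ := (wf_QT Φ).1 h
  obtain ⟨hr1, hr2, hr3, hr4⟩ := hr
  rw [kind_QT Φ h] at hk
  simp only [gateFanIn] at hk; norm_num at hk
  interval_cases k
  · rw [child_QT_0, depth_QT Φ h]
    have hw' := (wf_CSQ Φ (n := n) (len := len) (s := 0) (f1 := f1) (f2 := 0) (f3 := 0) (f4 := 0) (f5 := 0) (f6 := 0)).2 ⟨⟨by omega, by omega, by omega, by omega, by omega, by omega, by omega, by omega, hlen, hNpos⟩, by omega⟩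
    refine ⟨fits8 Φ (by omega) (by omega) (by omega) (by omega) (by omega) (by omega) (by omega) (by omega) hlen, hw', ?_⟩
    rw [depth_CSQ Φ hw']
    omega
  · rw [child_QT_1, depth_QT Φ h]
    have hw' := (wf_CSQ Φ (n := n) (len := len) (s := 1) (f1 := f1) (f2 := 0) (f3 := 0) (f4 := 0) (f5 := 0) (f6 := 0)).2 ⟨⟨by omega, by omega, by omega, by omega, by omega, by omega, by omega, by omega, hlen, hNpos⟩, by omega⟩
    refine ⟨fits8 Φ (by omega) (by omega) (by omega) (by omega) (by omega) (by omega) (by omega) (by omega) hlen, hw', ?_⟩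
    rw [depth_CSQ Φ hw']
    omega
  · rw [child_QT_2, depth_QT Φ h]
    have hw' := (wf_QT2 Φ (n := n) (len := len) (s := s) (f1 := f1) (f2 := f2) (f3 := f3) (f4 := f4) (f5 := 0) (f6 := 0)).2 ⟨⟨by omega, by omega, by omega, by omega, by omega, by omega, by omega, by omega, hlen, hNpos⟩, ⟨by omega, by omega, by omega, by omega⟩⟩
    refine ⟨fits8 Φ (by omega) (by omega) (by omega) (by omega) (by omega) (by omega) (by omega) (by omega) hlen, hw', ?_⟩
    rw [depth_QT2 Φ hw']
    omega
  · rw [child_QT_3, depth_QT Φ h]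
    have hw' := (wf_ZERO Φ (n := n) (len := len) (s := 0) (f1 := 0) (f2 := 0) (f3 := 0) (f4 := 0) (f5 := 0) (f6 := 0)).2 ⟨⟨by omega, by omega, by omega, by omega, by omega, by omega, by omega, by omega, hlen, hNpos⟩, trivial⟩
    refine ⟨fits8 Φ (by omega) (by omega) (by omega) (by omega) (by omega) (by omega) (by omega) (by omega) hlen, hw', ?_⟩
    rw [depth_ZERO Φ hw']
    omega

/-- Children of `QT2`: they fit, and they are shallower. [cite: KoiranPerifel2009VPSPACE, §3.2] -/
theorem step_QT2 (h : WF Φ n len [17, s, f1, f2, f3, f4, f5, f6]) (k : ℕ)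
    (hk : k < gateFanIn (kindX.eval (aenv Φ.params n len [17, s, f1, f2, f3, f4, f5, f6])) (arityX.eval (aenv Φ.params n len [17, s, f1, f2, f3, f4, f5, f6]))) :
    (gcore n (childX.map (AExp.eval (aenvK Φ.params n len [17, s, f1, f2, f3, f4, f5, f6] k)))).length ≤ len ∧
    WF Φ n len (childX.map (AExp.eval (aenvK Φ.params n len [17, s, f1, f2, f3, f4, f5, f6] k))) ∧
    depthX.eval (aenv Φ.params n len (childX.map (AExp.eval (aenvK Φ.params n len [17, s, f1, f2, f3, f4, f5, f6] k)))) <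
      depthX.eval (aenv Φ.params n len [17, s, f1, f2, f3, f4, f5, f6]) := by
  obtain ⟨hFB, h2X, h2R, h2NN, h2N1, hXeq, hTF, hTFB, hLreq⟩ := Φ.param_facts n
  obtain ⟨⟨h30, hs, hb1, hb2, hb3, hb4, hb5, hb6, hlen, hNpos⟩, hr⟩ := (wf_QT2 Φ).1 h
  obtain ⟨hr1, hr2, hr3, hr4⟩ := hr
  rw [kind_QT2 Φ h] at hk
  simp only [gateFanIn] at hk; norm_num at hk
  interval_cases k
  · rw [child_QT2_0, depth_QT2 Φ h]
    have hw' := (wf_C Φ (n := n) (len := len) (s := 0) (f1 := f1) (f2 := 0) (f3 := 0) (f4 := 0) (f5 := 0) (f6 := 0)).2 ⟨⟨by omega, by omega, by omega, by omega, by omega, by omega, by omega, by omega, hlen, hNpos⟩, by omega⟩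
    refine ⟨fits8 Φ (by omega) (by omega) (by omega) (by omega) (by omega) (by omega) (by omega) (by omega) hlen, hw', ?_⟩
    rw [depth_C Φ hw']
    omega
  · rw [child_QT2_1, depth_QT2 Φ h]
    have hw' := (wf_C Φ (n := n) (len := len) (s := 1) (f1 := f1) (f2 := 0) (f3 := 0) (f4 := 0) (f5 := 0) (f6 := 0)).2 ⟨⟨by omega, by omega, by omega, by omega, by omega, by omega, by omega, by omega, hlen, hNpos⟩, by omega⟩
    refine ⟨fits8 Φ (by omega) (by omega) (by omega) (by omega) (by omega) (by omega) (by omega) (by omega) hlen, hw', ?_⟩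
    rw [depth_C Φ hw']
    omega
  · rw [child_QT2_2, depth_QT2 Φ h]
    have hw' := (wf_ZERO Φ (n := n) (len := len) (s := 0) (f1 := 0) (f2 := 0) (f3 := 0) (f4 := 0) (f5 := 0) (f6 := 0)).2 ⟨⟨by omega, by omega, by omega, by omega, by omega, by omega, by omega, by omega, hlen, hNpos⟩, trivial⟩
    refine ⟨fits8 Φ (by omega) (by omega) (by omega) (by omega) (by omega) (by omega) (by omega) (by omega) hlen, hw', ?_⟩
    rw [depth_ZERO Φ hw']
    omega
  · rw [child_QT2_3, depth_QT2 Φ h]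
    have hw' := (wf_QK Φ (n := n) (len := len) (s := s) (f1 := f1) (f2 := f2) (f3 := f3) (f4 := f4) (f5 := 0) (f6 := 0)).2 ⟨⟨by omega, by omega, by omega, by omega, by omega, by omega, by omega, by omega, hlen, hNpos⟩, ⟨by omega, by omega, by omega, by omega⟩⟩
    refine ⟨fits8 Φ (by omega) (by omega) (by omega) (by omega) (by omega) (by omega) (by omega) (by omega) hlen, hw', ?_⟩
    rw [depth_QK Φ hw']
    omega

/-- Children of `QB`: they fit, and they are shallower. [cite: KoiranPerifel2009VPSPACE, §3.2] -/
theorem step_QB (h : WF Φ n len [18, s, f1, f2, f3, f4, f5, f6]) (k : ℕ)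
    (hk : k < gateFanIn (kindX.eval (aenv Φ.params n len [18, s, f1, f2, f3, f4, f5, f6])) (arityX.eval (aenv Φ.params n len [18, s, f1, f2, f3, f4, f5, f6]))) :
    (gcore n (childX.map (AExp.eval (aenvK Φ.params n len [18, s, f1, f2, f3, f4, f5, f6] k)))).length ≤ len ∧
    WF Φ n len (childX.map (AExp.eval (aenvK Φ.params n len [18, s, f1, f2, f3, f4, f5, f6] k))) ∧
    depthX.eval (aenv Φ.params n len (childX.map (AExp.eval (aenvK Φ.params n len [18, s, f1, f2, f3, f4, f5, f6] k)))) <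
      depthX.eval (aenv Φ.params n len [18, s, f1, f2, f3, f4, f5, f6]) := by
  obtain ⟨hFB, h2X, h2R, h2NN, h2N1, hXeq, hTF, hTFB, hLreq⟩ := Φ.param_facts n
  obtain ⟨⟨h30, hs, hb1, hb2, hb3, hb4, hb5, hb6, hlen, hNpos⟩, hr⟩ := (wf_QB Φ).1 h
  obtain ⟨hr1, hr2, hr3⟩ := hr
  rw [kind_QB Φ h, arity_QB Φ h] at hk
  simp only [gateFanIn] at hk; norm_num at hk
  rw [child_QB, depth_QB Φ h]
  have hw' := (wf_QT Φ (n := n) (len := len) (s := s) (f1 := k) (f2 := f1) (f3 := f2) (f4 := f3) (f5 := 0) (f6 := 0)).2 ⟨⟨by omega, by omega, by omega, by omega, by omega, by omega, by omega, by omega, hlen, hNpos⟩, ⟨by omega, by omega, by omega, by omega⟩⟩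
  refine ⟨fits8 Φ (by omega) (by omega) (by omega) (by omega) (by omega) (by omega) (by omega) (by omega) hlen, hw', ?_⟩
  rw [depth_QT Φ hw']
  omega

/-- Children of `QSQ`: they fit, and they are shallower. [cite: KoiranPerifel2009VPSPACE, §3.2] -/
theorem step_QSQ (h : WF Φ n len [19, s, f1, f2, f3, f4, f5, f6]) (k : ℕ)
    (hk : k < gateFanIn (kindX.eval (aenv Φ.params n len [19, s, f1, f2, f3, f4, f5, f6])) (arityX.eval (aenv Φ.params n len [19, s, f1, f2, f3, f4, f5, f6]))) :
    (gcore n (childX.map (AExp.eval (aenvK Φ.params n len [19, s, f1, f2, f3, f4, f5, f6] k)))).length ≤ len ∧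
    WF Φ n len (childX.map (AExp.eval (aenvK Φ.params n len [19, s, f1, f2, f3, f4, f5, f6] k))) ∧
    depthX.eval (aenv Φ.params n len (childX.map (AExp.eval (aenvK Φ.params n len [19, s, f1, f2, f3, f4, f5, f6] k)))) <
      depthX.eval (aenv Φ.params n len [19, s, f1, f2, f3, f4, f5, f6]) := by
  obtain ⟨hFB, h2X, h2R, h2NN, h2N1, hXeq, hTF, hTFB, hLreq⟩ := Φ.param_facts n
  obtain ⟨⟨h30, hs, hb1, hb2, hb3, hb4, hb5, hb6, hlen, hNpos⟩, hr⟩ := (wf_QSQ Φ).1 h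
  have hr1 := hr
  rw [kind_QSQ Φ h, arity_QSQ Φ h] at hk
  simp only [gateFanIn] at hk; norm_num at hk
  rw [child_QSQ, depth_QSQ Φ h]
  have hw' := (wf_PQ Φ (n := n) (len := len) (s := s) (f1 := f1) (f2 := k) (f3 := 0) (f4 := 0) (f5 := 0) (f6 := 0)).2 ⟨⟨by omega, by omega, by omega, by omega, by omega, by omega, by omega, by omega, hlen, hNpos⟩, ⟨by omega, by omega⟩⟩
  refine ⟨fits8 Φ (by omega) (by omega) (by omega) (by omega) (by omega) (by omega) (by omega) (by omega) hlen, hw', ?_⟩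
  rw [depth_PQ Φ hw']
  omega

/-- Children of `PQ`: they fit, and they are shallower. [cite: KoiranPerifel2009VPSPACE, §3.2] -/
theorem step_PQ (h : WF Φ n len [20, s, f1, f2, f3, f4, f5, f6]) (k : ℕ)
    (hk : k < gateFanIn (kindX.eval (aenv Φ.params n len [20, s, f1, f2, f3, f4, f5, f6])) (arityX.eval (aenv Φ.params n len [20, s, f1, f2, f3, f4, f5, f6]))) :
    (gcore n (childX.map (AExp.eval (aenvK Φ.params n len [20, s, f1, f2, f3, f4, f5, f6] k)))).length ≤ len ∧
    WF Φ n len (childX.map (AExp.eval (aenvK Φ.params n len [20, s, f1, f2, f3, f4, f5, f6] k))) ∧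
    depthX.eval (aenv Φ.params n len (childX.map (AExp.eval (aenvK Φ.params n len [20, s, f1, f2, f3, f4, f5, f6] k)))) <
      depthX.eval (aenv Φ.params n len [20, s, f1, f2, f3, f4, f5, f6]) := by
  obtain ⟨hFB, h2X, h2R, h2NN, h2N1, hXeq, hTF, hTFB, hLreq⟩ := Φ.param_facts n
  obtain ⟨⟨h30, hs, hb1, hb2, hb3, hb4, hb5, hb6, hlen, hNpos⟩, hr⟩ := (wf_PQ Φ).1 h
  obtain ⟨hr1, hr2⟩ := hr
  rw [kind_PQ Φ h] at hk
  simp only [gateFanIn] at hk; norm_num at hk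
  have hw2 : f2 / 2 < Φ.N n * Φ.N n := by omega
  have ha' : f2 / 2 / Φ.N n < Φ.N n := Nat.div_lt_of_lt_mul hw2
  have hb' : f2 / 2 % Φ.N n < Φ.N n := Nat.mod_lt _ hNpos
  have haF : f2 / 2 / Φ.N n < Φ.FB n := by omega
  have hbF : f2 / 2 % Φ.N n < Φ.FB n := by omega
  interval_cases k
  · rw [child_PQ_0, depth_PQ Φ h]
    have hw' := (wf_QB Φ (n := n) (len := len) (s := (f2 % 2)) (f1 := f1) (f2 := ((f2 / 2) / (Φ.N n))) (f3 := ((f2 / 2) % (Φ.N n))) (f4 := 0) (f5 := 0) (f6 := 0)).2 ⟨⟨by omega, by omega, by omega, by omega, by omega, by omega, by omega, by omega, hlen, hNpos⟩, ⟨by omega, by omega, by omega⟩⟩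
    refine ⟨fits8 Φ (by omega) (by omega) (by omega) (by omega) (by omega) (by omega) (by omega) (by omega) hlen, hw', ?_⟩
    rw [depth_QB Φ hw']
    omega
  · rw [child_PQ_1, depth_PQ Φ h]
    have hw' := (wf_QB Φ (n := n) (len := len) (s := (((f2 % 2) + s) % 2)) (f1 := f1) (f2 := ((f2 / 2) / (Φ.N n))) (f3 := ((f2 / 2) % (Φ.N n))) (f4 := 0) (f5 := 0) (f6 := 0)).2 ⟨⟨by omega, by omega, by omega, by omega, by omega, by omega, by omega, by omega, hlen, hNpos⟩, ⟨by omega, by omega, by omega⟩⟩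
    refine ⟨fits8 Φ (by omega) (by omega) (by omega) (by omega) (by omega) (by omega) (by omega) (by omega) hlen, hw', ?_⟩
    rw [depth_QB Φ hw']
    omega

/-- Children of `NT`: they fit, and they are shallower. [cite: KoiranPerifel2009VPSPACE, §3.2] -/
theorem step_NT (h : WF Φ n len [21, s, f1, f2, f3, f4, f5, f6]) (k : ℕ)
    (hk : k < gateFanIn (kindX.eval (aenv Φ.params n len [21, s, f1, f2, f3, f4, f5, f6])) (arityX.eval (aenv Φ.params n len [21, s, f1, f2, f3, f4, f5, f6]))) :
    (gcore n (childX.map (AExp.eval (aenvK Φ.params n len [21, s, f1, f2, f3, f4, f5, f6] k)))).length ≤ len ∧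
    WF Φ n len (childX.map (AExp.eval (aenvK Φ.params n len [21, s, f1, f2, f3, f4, f5, f6] k))) ∧
    depthX.eval (aenv Φ.params n len (childX.map (AExp.eval (aenvK Φ.params n len [21, s, f1, f2, f3, f4, f5, f6] k)))) <
      depthX.eval (aenv Φ.params n len [21, s, f1, f2, f3, f4, f5, f6]) := by
  obtain ⟨hFB, h2X, h2R, h2NN, h2N1, hXeq, hTF, hTFB, hLreq⟩ := Φ.param_facts n
  obtain ⟨⟨h30, hs, hb1, hb2, hb3, hb4, hb5, hb6, hlen, hNpos⟩, hr⟩ := (wf_NT Φ).1 h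
  obtain ⟨hr1, hr2, hr3⟩ := hr
  rw [kind_NT Φ h] at hk
  simp only [gateFanIn] at hk; norm_num at hk
  interval_cases k
  · rw [child_NT_0, depth_NT Φ h]
    have hw' := (wf_QSQ Φ (n := n) (len := len) (s := 0) (f1 := (f1 + 1)) (f2 := 0) (f3 := 0) (f4 := 0) (f5 := 0) (f6 := 0)).2 ⟨⟨by omega, by omega, by omega, by omega, by omega, by omega, by omega, by omega, hlen, hNpos⟩, by omega⟩
    refine ⟨fits8 Φ (by omega) (by omega) (by omega) (by omega) (by omega) (by omega) (by omega) (by omega) hlen, hw', ?_⟩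
    rw [depth_QSQ Φ hw']
    omega
  · rw [child_NT_1, depth_NT Φ h]
    have hw' := (wf_QSQ Φ (n := n) (len := len) (s := 1) (f1 := (f1 + 1)) (f2 := 0) (f3 := 0) (f4 := 0) (f5 := 0) (f6 := 0)).2 ⟨⟨by omega, by omega, by omega, by omega, by omega, by omega, by omega, by omega, hlen, hNpos⟩, by omega⟩
    refine ⟨fits8 Φ (by omega) (by omega) (by omega) (by omega) (by omega) (by omega) (by omega) (by omega) hlen, hw', ?_⟩
    rw [depth_QSQ Φ hw']
    omega
  · rw [child_NT_2, depth_NT Φ h]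
    have hw' := (wf_NT2 Φ (n := n) (len := len) (s := s) (f1 := f1) (f2 := f2) (f3 := f3) (f4 := 0) (f5 := 0) (f6 := 0)).2 ⟨⟨by omega, by omega, by omega, by omega, by omega, by omega, by omega, by omega, hlen, hNpos⟩, ⟨by omega, by omega, by omega⟩⟩
    refine ⟨fits8 Φ (by omega) (by omega) (by omega) (by omega) (by omega) (by omega) (by omega) (by omega) hlen, hw', ?_⟩
    rw [depth_NT2 Φ hw']
    omega
  · rw [child_NT_3, depth_NT Φ h]
    have hw' := (wf_ZERO Φ (n := n) (len := len) (s := 0) (f1 := 0) (f2 := 0) (f3 := 0) (f4 := 0) (f5 := 0) (f6 := 0)).2 ⟨⟨by omega, by omega, by omega, by omega, by omega, by omega, by omega, by omega, hlen, hNpos⟩, trivial⟩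
    refine ⟨fits8 Φ (by omega) (by omega) (by omega) (by omega) (by omega) (by omega) (by omega) (by omega) hlen, hw', ?_⟩
    rw [depth_ZERO Φ hw']
    omega

/-- Children of `NT2`: they fit, and they are shallower. [cite: KoiranPerifel2009VPSPACE, §3.2] -/
theorem step_NT2 (h : WF Φ n len [22, s, f1, f2, f3, f4, f5, f6]) (k : ℕ)
    (hk : k < gateFanIn (kindX.eval (aenv Φ.params n len [22, s, f1, f2, f3, f4, f5, f6])) (arityX.eval (aenv Φ.params n len [22, s, f1, f2, f3, f4, f5, f6]))) :
    (gcore n (childX.map (AExp.eval (aenvK Φ.params n len [22, s, f1, f2, f3, f4, f5, f6] k)))).length ≤ len ∧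
    WF Φ n len (childX.map (AExp.eval (aenvK Φ.params n len [22, s, f1, f2, f3, f4, f5, f6] k))) ∧
    depthX.eval (aenv Φ.params n len (childX.map (AExp.eval (aenvK Φ.params n len [22, s, f1, f2, f3, f4, f5, f6] k)))) <
      depthX.eval (aenv Φ.params n len [22, s, f1, f2, f3, f4, f5, f6]) := by
  obtain ⟨hFB, h2X, h2R, h2NN, h2N1, hXeq, hTF, hTFB, hLreq⟩ := Φ.param_facts n
  obtain ⟨⟨h30, hs, hb1, hb2, hb3, hb4, hb5, hb6, hlen, hNpos⟩, hr⟩ := (wf_NT2 Φ).1 h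
  obtain ⟨hr1, hr2, hr3⟩ := hr
  rw [kind_NT2 Φ h] at hk
  simp only [gateFanIn] at hk; norm_num at hk
  interval_cases k
  · rw [child_NT2_0, depth_NT2 Φ h]
    have hw' := (wf_QSQ Φ (n := n) (len := len) (s := 0) (f1 := f1) (f2 := 0) (f3 := 0) (f4 := 0) (f5 := 0) (f6 := 0)).2 ⟨⟨by omega, by omega, by omega, by omega, by omega, by omega, by omega, by omega, hlen, hNpos⟩, by omega⟩
    refine ⟨fits8 Φ (by omega) (by omega) (by omega) (by omega) (by omega) (by omega) (by omega) (by omega) hlen, hw', ?_⟩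
    rw [depth_QSQ Φ hw']
    omega
  · rw [child_NT2_1, depth_NT2 Φ h]
    have hw' := (wf_QSQ Φ (n := n) (len := len) (s := 1) (f1 := f1) (f2 := 0) (f3 := 0) (f4 := 0) (f5 := 0) (f6 := 0)).2 ⟨⟨by omega, by omega, by omega, by omega, by omega, by omega, by omega, by omega, hlen, hNpos⟩, by omega⟩
    refine ⟨fits8 Φ (by omega) (by omega) (by omega) (by omega) (by omega) (by omega) (by omega) (by omega) hlen, hw', ?_⟩
    rw [depth_QSQ Φ hw']
    omega
  · rw [child_NT2_2, depth_NT2 Φ h]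
    have hw' := (wf_ZERO Φ (n := n) (len := len) (s := 0) (f1 := 0) (f2 := 0) (f3 := 0) (f4 := 0) (f5 := 0) (f6 := 0)).2 ⟨⟨by omega, by omega, by omega, by omega, by omega, by omega, by omega, by omega, hlen, hNpos⟩, trivial⟩
    refine ⟨fits8 Φ (by omega) (by omega) (by omega) (by omega) (by omega) (by omega) (by omega) (by omega) hlen, hw', ?_⟩
    rw [depth_ZERO Φ hw']
    omega
  · rw [child_NT2_3, depth_NT2 Φ h]
    have hw' := (wf_QB Φ (n := n) (len := len) (s := s) (f1 := f1) (f2 := f2) (f3 := f3) (f4 := 0) (f5 := 0) (f6 := 0)).2 ⟨⟨by omega, by omega, by omega, by omega, by omega, by omega, by omega, by omega, hlen, hNpos⟩, ⟨by omega, by omega, by omega⟩⟩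
    refine ⟨fits8 Φ (by omega) (by omega) (by omega) (by omega) (by omega) (by omega) (by omega) (by omega) hlen, hw', ?_⟩
    rw [depth_QB Φ hw']
    omega

/-- Children of `NB`: they fit, and they are shallower. [cite: KoiranPerifel2009VPSPACE, §3.2] -/
theorem step_NB (h : WF Φ n len [23, s, f1, f2, f3, f4, f5, f6]) (k : ℕ)
    (hk : k < gateFanIn (kindX.eval (aenv Φ.params n len [23, s, f1, f2, f3, f4, f5, f6])) (arityX.eval (aenv Φ.params n len [23, s, f1, f2, f3, f4, f5, f6]))) :
    (gcore n (childX.map (AExp.eval (aenvK Φ.params n len [23, s, f1, f2, f3, f4, f5, f6] k)))).length ≤ len ∧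
    WF Φ n len (childX.map (AExp.eval (aenvK Φ.params n len [23, s, f1, f2, f3, f4, f5, f6] k))) ∧
    depthX.eval (aenv Φ.params n len (childX.map (AExp.eval (aenvK Φ.params n len [23, s, f1, f2, f3, f4, f5, f6] k)))) <
      depthX.eval (aenv Φ.params n len [23, s, f1, f2, f3, f4, f5, f6]) := by
  obtain ⟨hFB, h2X, h2R, h2NN, h2N1, hXeq, hTF, hTFB, hLreq⟩ := Φ.param_facts n
  obtain ⟨⟨h30, hs, hb1, hb2, hb3, hb4, hb5, hb6, hlen, hNpos⟩, hr⟩ := (wf_NB Φ).1 h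
  obtain ⟨hr1, hr2⟩ := hr
  rw [kind_NB Φ h, arity_NB Φ h] at hk
  simp only [gateFanIn] at hk; norm_num at hk
  rw [child_NB, depth_NB Φ h]
  have hw' := (wf_NT Φ (n := n) (len := len) (s := s) (f1 := k) (f2 := f1) (f3 := f2) (f4 := 0) (f5 := 0) (f6 := 0)).2 ⟨⟨by omega, by omega, by omega, by omega, by omega, by omega, by omega, by omega, hlen, hNpos⟩, ⟨by omega, by omega, by omega⟩⟩
  refine ⟨fits8 Φ (by omega) (by omega) (by omega) (by omega) (by omega) (by omega) (by omega) (by omega) hlen, hw', ?_⟩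
  rw [depth_NT Φ hw']
  omega

/-- Children of `COLSQ`: they fit, and they are shallower. [cite: KoiranPerifel2009VPSPACE, §3.2] -/
theorem step_COLSQ (h : WF Φ n len [24, s, f1, f2, f3, f4, f5, f6]) (k : ℕ)
    (hk : k < gateFanIn (kindX.eval (aenv Φ.params n len [24, s, f1, f2, f3, f4, f5, f6])) (arityX.eval (aenv Φ.params n len [24, s, f1, f2, f3, f4, f5, f6]))) :
    (gcore n (childX.map (AExp.eval (aenvK Φ.params n len [24, s, f1, f2, f3, f4, f5, f6] k)))).length ≤ len ∧
    WF Φ n len (childX.map (AExp.eval (aenvK Φ.params n len [24, s, f1, f2, f3, f4, f5, f6] k))) ∧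
    depthX.eval (aenv Φ.params n len (childX.map (AExp.eval (aenvK Φ.params n len [24, s, f1, f2, f3, f4, f5, f6] k)))) <
      depthX.eval (aenv Φ.params n len [24, s, f1, f2, f3, f4, f5, f6]) := by
  obtain ⟨hFB, h2X, h2R, h2NN, h2N1, hXeq, hTF, hTFB, hLreq⟩ := Φ.param_facts n
  obtain ⟨⟨h30, hs, hb1, hb2, hb3, hb4, hb5, hb6, hlen, hNpos⟩, hr⟩ := (wf_COLSQ Φ).1 h
  have hr1 := hr
  rw [kind_COLSQ Φ h, arity_COLSQ Φ h] at hk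
  simp only [gateFanIn] at hk; norm_num at hk
  rw [child_COLSQ, depth_COLSQ Φ h]
  have hw' := (wf_PN Φ (n := n) (len := len) (s := s) (f1 := f1) (f2 := k) (f3 := 0) (f4 := 0) (f5 := 0) (f6 := 0)).2 ⟨⟨by omega, by omega, by omega, by omega, by omega, by omega, by omega, by omega, hlen, hNpos⟩, ⟨by omega, by omega⟩⟩
  refine ⟨fits8 Φ (by omega) (by omega) (by omega) (by omega) (by omega) (by omega) (by omega) (by omega) hlen, hw', ?_⟩
  rw [depth_PN Φ hw']
  omega

/-- Children of `PN`: they fit, and they are shallower. [cite: KoiranPerifel2009VPSPACE, §3.2] -/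
theorem step_PN (h : WF Φ n len [25, s, f1, f2, f3, f4, f5, f6]) (k : ℕ)
    (hk : k < gateFanIn (kindX.eval (aenv Φ.params n len [25, s, f1, f2, f3, f4, f5, f6])) (arityX.eval (aenv Φ.params n len [25, s, f1, f2, f3, f4, f5, f6]))) :
    (gcore n (childX.map (AExp.eval (aenvK Φ.params n len [25, s, f1, f2, f3, f4, f5, f6] k)))).length ≤ len ∧
    WF Φ n len (childX.map (AExp.eval (aenvK Φ.params n len [25, s, f1, f2, f3, f4, f5, f6] k))) ∧
    depthX.eval (aenv Φ.params n len (childX.map (AExp.eval (aenvK Φ.params n len [25, s, f1, f2, f3, f4, f5, f6] k)))) <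
      depthX.eval (aenv Φ.params n len [25, s, f1, f2, f3, f4, f5, f6]) := by
  obtain ⟨hFB, h2X, h2R, h2NN, h2N1, hXeq, hTF, hTFB, hLreq⟩ := Φ.param_facts n
  obtain ⟨⟨h30, hs, hb1, hb2, hb3, hb4, hb5, hb6, hlen, hNpos⟩, hr⟩ := (wf_PN Φ).1 h
  obtain ⟨hr1, hr2⟩ := hr
  rw [kind_PN Φ h] at hk
  simp only [gateFanIn] at hk; norm_num at hk
  interval_cases k
  · rw [child_PN_0, depth_PN Φ h]
    have hw' := (wf_NB Φ (n := n) (len := len) (s := (f2 % 2)) (f1 := (f2 / 2)) (f2 := f1) (f3 := 0) (f4 := 0) (f5 := 0) (f6 := 0)).2 ⟨⟨by omega, by omega, by omega, by omega, by omega, by omega, by omega, by omega, hlen, hNpos⟩, ⟨by omega, by omega⟩⟩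
    refine ⟨fits8 Φ (by omega) (by omega) (by omega) (by omega) (by omega) (by omega) (by omega) (by omega) hlen, hw', ?_⟩
    rw [depth_NB Φ hw']
    omega
  · rw [child_PN_1, depth_PN Φ h]
    have hw' := (wf_NB Φ (n := n) (len := len) (s := (((f2 % 2) + s) % 2)) (f1 := (f2 / 2)) (f2 := f1) (f3 := 0) (f4 := 0) (f5 := 0) (f6 := 0)).2 ⟨⟨by omega, by omega, by omega, by omega, by omega, by omega, by omega, by omega, hlen, hNpos⟩, ⟨by omega, by omega⟩⟩
    refine ⟨fits8 Φ (by omega) (by omega) (by omega) (by omega) (by omega) (by omega) (by omega) (by omega) hlen, hw', ?_⟩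
    rw [depth_NB Φ hw']
    omega

/-- Children of `PRE`: they fit, and they are shallower. [cite: KoiranPerifel2009VPSPACE, §3.2] -/
theorem step_PRE (h : WF Φ n len [26, s, f1, f2, f3, f4, f5, f6]) (k : ℕ)
    (hk : k < gateFanIn (kindX.eval (aenv Φ.params n len [26, s, f1, f2, f3, f4, f5, f6])) (arityX.eval (aenv Φ.params n len [26, s, f1, f2, f3, f4, f5, f6]))) :
    (gcore n (childX.map (AExp.eval (aenvK Φ.params n len [26, s, f1, f2, f3, f4, f5, f6] k)))).length ≤ len ∧
    WF Φ n len (childX.map (AExp.eval (aenvK Φ.params n len [26, s, f1, f2, f3, f4, f5, f6] k))) ∧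
    depthX.eval (aenv Φ.params n len (childX.map (AExp.eval (aenvK Φ.params n len [26, s, f1, f2, f3, f4, f5, f6] k)))) <
      depthX.eval (aenv Φ.params n len [26, s, f1, f2, f3, f4, f5, f6]) := by
  obtain ⟨hFB, h2X, h2R, h2NN, h2N1, hXeq, hTF, hTFB, hLreq⟩ := Φ.param_facts n
  obtain ⟨⟨h30, hs, hb1, hb2, hb3, hb4, hb5, hb6, hlen, hNpos⟩, hr⟩ := (wf_PRE Φ).1 h
  have hr1 := hr
  rw [kind_PRE Φ h, arity_PRE Φ h] at hk
  simp only [gateFanIn] at hk; norm_num at hk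
  rw [child_PRE, depth_PRE Φ h]
  have hw' := (wf_COLSQ Φ (n := n) (len := len) (s := s) (f1 := k) (f2 := 0) (f3 := 0) (f4 := 0) (f5 := 0) (f6 := 0)).2 ⟨⟨by omega, by omega, by omega, by omega, by omega, by omega, by omega, by omega, hlen, hNpos⟩, by omega⟩
  refine ⟨fits8 Φ (by omega) (by omega) (by omega) (by omega) (by omega) (by omega) (by omega) (by omega) hlen, hw', ?_⟩
  rw [depth_COLSQ Φ hw']
  omega

/-- Children of `VT`: they fit, and they are shallower. [cite: KoiranPerifel2009VPSPACE, §3.2] -/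
theorem step_VT (h : WF Φ n len [27, s, f1, f2, f3, f4, f5, f6]) (k : ℕ)
    (hk : k < gateFanIn (kindX.eval (aenv Φ.params n len [27, s, f1, f2, f3, f4, f5, f6])) (arityX.eval (aenv Φ.params n len [27, s, f1, f2, f3, f4, f5, f6]))) :
    (gcore n (childX.map (AExp.eval (aenvK Φ.params n len [27, s, f1, f2, f3, f4, f5, f6] k)))).length ≤ len ∧
    WF Φ n len (childX.map (AExp.eval (aenvK Φ.params n len [27, s, f1, f2, f3, f4, f5, f6] k))) ∧
    depthX.eval (aenv Φ.params n len (childX.map (AExp.eval (aenvK Φ.params n len [27, s, f1, f2, f3, f4, f5, f6] k)))) <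
      depthX.eval (aenv Φ.params n len [27, s, f1, f2, f3, f4, f5, f6]) := by
  obtain ⟨hFB, h2X, h2R, h2NN, h2N1, hXeq, hTF, hTFB, hLreq⟩ := Φ.param_facts n
  obtain ⟨⟨h30, hs, hb1, hb2, hb3, hb4, hb5, hb6, hlen, hNpos⟩, hr⟩ := (wf_VT Φ).1 h
  obtain ⟨hr1, hr2⟩ := hr
  rw [kind_VT Φ h] at hk
  simp only [gateFanIn] at hk; norm_num at hk
  interval_cases k
  · rw [child_VT_0, depth_VT Φ h]
    have hw' := (wf_PRE Φ (n := n) (len := len) (s := 0) (f1 := f1) (f2 := 0) (f3 := 0) (f4 := 0) (f5 := 0) (f6 := 0)).2 ⟨⟨by omega, by omega, by omega, by omega, by omega, by omega, by omega, by omega, hlen, hNpos⟩, by omega⟩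
    refine ⟨fits8 Φ (by omega) (by omega) (by omega) (by omega) (by omega) (by omega) (by omega) (by omega) hlen, hw', ?_⟩
    rw [depth_PRE Φ hw']
    omega
  · rw [child_VT_1, depth_VT Φ h]
    have hw' := (wf_PRE Φ (n := n) (len := len) (s := 1) (f1 := f1) (f2 := 0) (f3 := 0) (f4 := 0) (f5 := 0) (f6 := 0)).2 ⟨⟨by omega, by omega, by omega, by omega, by omega, by omega, by omega, by omega, hlen, hNpos⟩, by omega⟩
    refine ⟨fits8 Φ (by omega) (by omega) (by omega) (by omega) (by omega) (by omega) (by omega) (by omega) hlen, hw', ?_⟩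
    rw [depth_PRE Φ hw']
    omega
  · rw [child_VT_2, depth_VT Φ h]
    have hw' := (wf_VT2 Φ (n := n) (len := len) (s := s) (f1 := f1) (f2 := f2) (f3 := 0) (f4 := 0) (f5 := 0) (f6 := 0)).2 ⟨⟨by omega, by omega, by omega, by omega, by omega, by omega, by omega, by omega, hlen, hNpos⟩, ⟨by omega, by omega⟩⟩
    refine ⟨fits8 Φ (by omega) (by omega) (by omega) (by omega) (by omega) (by omega) (by omega) (by omega) hlen, hw', ?_⟩
    rw [depth_VT2 Φ hw']
    omega
  · rw [child_VT_3, depth_VT Φ h]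
    have hw' := (wf_ZERO Φ (n := n) (len := len) (s := 0) (f1 := 0) (f2 := 0) (f3 := 0) (f4 := 0) (f5 := 0) (f6 := 0)).2 ⟨⟨by omega, by omega, by omega, by omega, by omega, by omega, by omega, by omega, hlen, hNpos⟩, trivial⟩
    refine ⟨fits8 Φ (by omega) (by omega) (by omega) (by omega) (by omega) (by omega) (by omega) (by omega) hlen, hw', ?_⟩
    rw [depth_ZERO Φ hw']
    omega

/-- Children of `VT2`: they fit, and they are shallower. [cite: KoiranPerifel2009VPSPACE, §3.2] -/
theorem step_VT2 (h : WF Φ n len [28, s, f1, f2, f3, f4, f5, f6]) (k : ℕ)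
    (hk : k < gateFanIn (kindX.eval (aenv Φ.params n len [28, s, f1, f2, f3, f4, f5, f6])) (arityX.eval (aenv Φ.params n len [28, s, f1, f2, f3, f4, f5, f6]))) :
    (gcore n (childX.map (AExp.eval (aenvK Φ.params n len [28, s, f1, f2, f3, f4, f5, f6] k)))).length ≤ len ∧
    WF Φ n len (childX.map (AExp.eval (aenvK Φ.params n len [28, s, f1, f2, f3, f4, f5, f6] k))) ∧
    depthX.eval (aenv Φ.params n len (childX.map (AExp.eval (aenvK Φ.params n len [28, s, f1, f2, f3, f4, f5, f6] k)))) <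
      depthX.eval (aenv Φ.params n len [28, s, f1, f2, f3, f4, f5, f6]) := by
  obtain ⟨hFB, h2X, h2R, h2NN, h2N1, hXeq, hTF, hTFB, hLreq⟩ := Φ.param_facts n
  obtain ⟨⟨h30, hs, hb1, hb2, hb3, hb4, hb5, hb6, hlen, hNpos⟩, hr⟩ := (wf_VT2 Φ).1 h
  obtain ⟨hr1, hr2⟩ := hr
  rw [kind_VT2 Φ h] at hk
  simp only [gateFanIn] at hk; norm_num at hk
  interval_cases k
  · rw [child_VT2_0, depth_VT2 Φ h]
    have hw' := (wf_COLSQ Φ (n := n) (len := len) (s := 0) (f1 := f1) (f2 := 0) (f3 := 0) (f4 := 0) (f5 := 0) (f6 := 0)).2 ⟨⟨by omega, by omega, by omega, by omega, by omega, by omega, by omega, by omega, hlen, hNpos⟩, by omega⟩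
    refine ⟨fits8 Φ (by omega) (by omega) (by omega) (by omega) (by omega) (by omega) (by omega) (by omega) hlen, hw', ?_⟩
    rw [depth_COLSQ Φ hw']
    omega
  · rw [child_VT2_1, depth_VT2 Φ h]
    have hw' := (wf_COLSQ Φ (n := n) (len := len) (s := 1) (f1 := f1) (f2 := 0) (f3 := 0) (f4 := 0) (f5 := 0) (f6 := 0)).2 ⟨⟨by omega, by omega, by omega, by omega, by omega, by omega, by omega, by omega, hlen, hNpos⟩, by omega⟩
    refine ⟨fits8 Φ (by omega) (by omega) (by omega) (by omega) (by omega) (by omega) (by omega) (by omega) hlen, hw', ?_⟩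
    rw [depth_COLSQ Φ hw']
    omega
  · rw [child_VT2_2, depth_VT2 Φ h]
    have hw' := (wf_ZERO Φ (n := n) (len := len) (s := 0) (f1 := 0) (f2 := 0) (f3 := 0) (f4 := 0) (f5 := 0) (f6 := 0)).2 ⟨⟨by omega, by omega, by omega, by omega, by omega, by omega, by omega, by omega, hlen, hNpos⟩, trivial⟩
    refine ⟨fits8 Φ (by omega) (by omega) (by omega) (by omega) (by omega) (by omega) (by omega) (by omega) hlen, hw', ?_⟩
    rw [depth_ZERO Φ hw']
    omega
  · rw [child_VT2_3, depth_VT2 Φ h]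
    have hw' := (wf_NB Φ (n := n) (len := len) (s := s) (f1 := f2) (f2 := f1) (f3 := 0) (f4 := 0) (f5 := 0) (f6 := 0)).2 ⟨⟨by omega, by omega, by omega, by omega, by omega, by omega, by omega, by omega, hlen, hNpos⟩, ⟨by omega, by omega⟩⟩
    refine ⟨fits8 Φ (by omega) (by omega) (by omega) (by omega) (by omega) (by omega) (by omega) (by omega) hlen, hw', ?_⟩
    rw [depth_NB Φ hw']
    omega

/-- Children of `V`: they fit, and they are shallower. [cite: KoiranPerifel2009VPSPACE, §3.2] -/
theorem step_V (h : WF Φ n len [29, s, f1, f2, f3, f4, f5, f6]) (k : ℕ)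
    (hk : k < gateFanIn (kindX.eval (aenv Φ.params n len [29, s, f1, f2, f3, f4, f5, f6])) (arityX.eval (aenv Φ.params n len [29, s, f1, f2, f3, f4, f5, f6]))) :
    (gcore n (childX.map (AExp.eval (aenvK Φ.params n len [29, s, f1, f2, f3, f4, f5, f6] k)))).length ≤ len ∧
    WF Φ n len (childX.map (AExp.eval (aenvK Φ.params n len [29, s, f1, f2, f3, f4, f5, f6] k))) ∧
    depthX.eval (aenv Φ.params n len (childX.map (AExp.eval (aenvK Φ.params n len [29, s, f1, f2, f3, f4, f5, f6] k)))) <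
      depthX.eval (aenv Φ.params n len [29, s, f1, f2, f3, f4, f5, f6]) := by
  obtain ⟨hFB, h2X, h2R, h2NN, h2N1, hXeq, hTF, hTFB, hLreq⟩ := Φ.param_facts n
  obtain ⟨⟨h30, hs, hb1, hb2, hb3, hb4, hb5, hb6, hlen, hNpos⟩, hr⟩ := (wf_V Φ).1 h
  have hr1 := hr
  rw [kind_V Φ h, arity_V Φ h] at hk
  simp only [gateFanIn] at hk; norm_num at hk
  rw [child_V, depth_V Φ h]
  have hw' := (wf_VT Φ (n := n) (len := len) (s := s) (f1 := k) (f2 := f1) (f3 := 0) (f4 := 0) (f5 := 0) (f6 := 0)).2 ⟨⟨by omega, by omega, by omega, by omega, by omega, by omega, by omega, by omega, hlen, hNpos⟩, ⟨by omega, by omega⟩⟩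
  refine ⟨fits8 Φ (by omega) (by omega) (by omega) (by omega) (by omega) (by omega) (by omega) (by omega) hlen, hw', ?_⟩
  rw [depth_VT Φ hw']
  omega

/-- `ZERO` has no children. [cite: KoiranPerifel2009VPSPACE, §3.2] -/
theorem step_ZERO (h : WF Φ n len [30, s, f1, f2, f3, f4, f5, f6]) (k : ℕ)
    (hk : k < gateFanIn (kindX.eval (aenv Φ.params n len [30, s, f1, f2, f3, f4, f5, f6])) (arityX.eval (aenv Φ.params n len [30, s, f1, f2, f3, f4, f5, f6]))) :
    (gcore n (childX.map (AExp.eval (aenvK Φ.params n len [30, s, f1, f2, f3, f4, f5, f6] k)))).length ≤ len ∧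
    WF Φ n len (childX.map (AExp.eval (aenvK Φ.params n len [30, s, f1, f2, f3, f4, f5, f6] k))) ∧
    depthX.eval (aenv Φ.params n len (childX.map (AExp.eval (aenvK Φ.params n len [30, s, f1, f2, f3, f4, f5, f6] k)))) <
      depthX.eval (aenv Φ.params n len [30, s, f1, f2, f3, f4, f5, f6]) := by
  exfalso; rw [kind_ZERO Φ h] at hk; simp [gateFanIn] at hk

/-- The depth of `ONE` is at most `dmax = 4F + 22`. [cite: KoiranPerifel2009VPSPACE, §3.2] -/
theorem dle_ONE (h : WF Φ n len [0, s, f1, f2, f3, f4, f5, f6]) : depthX.eval (aenv Φ.params n len [0, s, f1, f2, f3, f4, f5, f6]) ≤ Φ.dmax n := by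
  obtain ⟨hFB, h2X, h2R, h2NN, h2N1, hXeq, hTF, hTFB, hLreq⟩ := Φ.param_facts n
  obtain ⟨⟨h30, hs, hb1, hb2, hb3, hb4, hb5, hb6, hlen, hNpos⟩, hr⟩ := (wf_ONE Φ).1 h
  rw [depth_ONE Φ h]
  unfold SuccIntMatrixFamily.dmax; omega

/-- The depth of `A` is at most `dmax = 4F + 22`. [cite: KoiranPerifel2009VPSPACE, §3.2] -/
theorem dle_A (h : WF Φ n len [1, s, f1, f2, f3, f4, f5, f6]) : depthX.eval (aenv Φ.params n len [1, s, f1, f2, f3, f4, f5, f6]) ≤ Φ.dmax n := by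
  obtain ⟨hFB, h2X, h2R, h2NN, h2N1, hXeq, hTF, hTFB, hLreq⟩ := Φ.param_facts n
  obtain ⟨⟨h30, hs, hb1, hb2, hb3, hb4, hb5, hb6, hlen, hNpos⟩, hr⟩ := (wf_A Φ).1 h
  obtain ⟨hr1, hr2⟩ := hr
  rw [depth_A Φ h]
  unfold SuccIntMatrixFamily.dmax; omega

/-- The depth of `B` is at most `dmax = 4F + 22`. [cite: KoiranPerifel2009VPSPACE, §3.2] -/
theorem dle_B (h : WF Φ n len [2, s, f1, f2, f3, f4, f5, f6]) : depthX.eval (aenv Φ.params n len [2, s, f1, f2, f3, f4, f5, f6]) ≤ Φ.dmax n := by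
  obtain ⟨hFB, h2X, h2R, h2NN, h2N1, hXeq, hTF, hTFB, hLreq⟩ := Φ.param_facts n
  obtain ⟨⟨h30, hs, hb1, hb2, hb3, hb4, hb5, hb6, hlen, hNpos⟩, hr⟩ := (wf_B Φ).1 h
  obtain ⟨hr1, hr2⟩ := hr
  rw [depth_B Φ h]
  unfold SuccIntMatrixFamily.dmax; omega

/-- The depth of `PA` is at most `dmax = 4F + 22`. [cite: KoiranPerifel2009VPSPACE, §3.2] -/
theorem dle_PA (h : WF Φ n len [3, s, f1, f2, f3, f4, f5, f6]) : depthX.eval (aenv Φ.params n len [3, s, f1, f2, f3, f4, f5, f6]) ≤ Φ.dmax n := by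
  obtain ⟨hFB, h2X, h2R, h2NN, h2N1, hXeq, hTF, hTFB, hLreq⟩ := Φ.param_facts n
  obtain ⟨⟨h30, hs, hb1, hb2, hb3, hb4, hb5, hb6, hlen, hNpos⟩, hr⟩ := (wf_PA Φ).1 h
  obtain ⟨hr1, hr2, hr3⟩ := hr
  rw [depth_PA Φ h]
  unfold SuccIntMatrixFamily.dmax; omega

/-- The depth of `M` is at most `dmax = 4F + 22`. [cite: KoiranPerifel2009VPSPACE, §3.2] -/
theorem dle_M (h : WF Φ n len [4, s, f1, f2, f3, f4, f5, f6]) : depthX.eval (aenv Φ.params n len [4, s, f1, f2, f3, f4, f5, f6]) ≤ Φ.dmax n := by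
  obtain ⟨hFB, h2X, h2R, h2NN, h2N1, hXeq, hTF, hTFB, hLreq⟩ := Φ.param_facts n
  obtain ⟨⟨h30, hs, hb1, hb2, hb3, hb4, hb5, hb6, hlen, hNpos⟩, hr⟩ := (wf_M Φ).1 h
  obtain ⟨hr1, hr2⟩ := hr
  rw [depth_M Φ h]
  unfold SuccIntMatrixFamily.dmax; omega

/-- The depth of `P` is at most `dmax = 4F + 22`. [cite: KoiranPerifel2009VPSPACE, §3.2] -/
theorem dle_P (h : WF Φ n len [5, s, f1, f2, f3, f4, f5, f6]) : depthX.eval (aenv Φ.params n len [5, s, f1, f2, f3, f4, f5, f6]) ≤ Φ.dmax n := by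
  obtain ⟨hFB, h2X, h2R, h2NN, h2N1, hXeq, hTF, hTFB, hLreq⟩ := Φ.param_facts n
  obtain ⟨⟨h30, hs, hb1, hb2, hb3, hb4, hb5, hb6, hlen, hNpos⟩, hr⟩ := (wf_P Φ).1 h
  obtain ⟨hr1, hr2, hr3⟩ := hr
  rw [depth_P Φ h]
  unfold SuccIntMatrixFamily.dmax; omega

/-- The depth of `PP` is at most `dmax = 4F + 22`. [cite: KoiranPerifel2009VPSPACE, §3.2] -/
theorem dle_PP (h : WF Φ n len [6, s, f1, f2, f3, f4, f5, f6]) : depthX.eval (aenv Φ.params n len [6, s, f1, f2, f3, f4, f5, f6]) ≤ Φ.dmax n := by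
  obtain ⟨hFB, h2X, h2R, h2NN, h2N1, hXeq, hTF, hTFB, hLreq⟩ := Φ.param_facts n
  obtain ⟨⟨h30, hs, hb1, hb2, hb3, hb4, hb5, hb6, hlen, hNpos⟩, hr⟩ := (wf_PP Φ).1 h
  obtain ⟨hr1, hr2, hr3, hr4, hr5⟩ := hr
  rw [depth_PP Φ h]
  unfold SuccIntMatrixFamily.dmax; omega

/-- The depth of `C` is at most `dmax = 4F + 22`. [cite: KoiranPerifel2009VPSPACE, §3.2] -/
theorem dle_C (h : WF Φ n len [7, s, f1, f2, f3, f4, f5, f6]) : depthX.eval (aenv Φ.params n len [7, s, f1, f2, f3, f4, f5, f6]) ≤ Φ.dmax n := by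
  obtain ⟨hFB, h2X, h2R, h2NN, h2N1, hXeq, hTF, hTFB, hLreq⟩ := Φ.param_facts n
  obtain ⟨⟨h30, hs, hb1, hb2, hb3, hb4, hb5, hb6, hlen, hNpos⟩, hr⟩ := (wf_C Φ).1 h
  have hr1 := hr
  rw [depth_C Φ h]
  unfold SuccIntMatrixFamily.dmax; omega

/-- The depth of `BP` is at most `dmax = 4F + 22`. [cite: KoiranPerifel2009VPSPACE, §3.2] -/
theorem dle_BP (h : WF Φ n len [8, s, f1, f2, f3, f4, f5, f6]) : depthX.eval (aenv Φ.params n len [8, s, f1, f2, f3, f4, f5, f6]) ≤ Φ.dmax n := by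
  obtain ⟨hFB, h2X, h2R, h2NN, h2N1, hXeq, hTF, hTFB, hLreq⟩ := Φ.param_facts n
  obtain ⟨⟨h30, hs, hb1, hb2, hb3, hb4, hb5, hb6, hlen, hNpos⟩, hr⟩ := (wf_BP Φ).1 h
  obtain ⟨hr1, hr2, hr3⟩ := hr
  have hsz : Nat.size f1 ≤ Φ.F n + 1 := Φ.size_le_of_le_two_N hr1
  rw [depth_BP Φ h]
  unfold SuccIntMatrixFamily.dmax; omega

/-- The depth of `SQ` is at most `dmax = 4F + 22`. [cite: KoiranPerifel2009VPSPACE, §3.2] -/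
theorem dle_SQ (h : WF Φ n len [9, s, f1, f2, f3, f4, f5, f6]) : depthX.eval (aenv Φ.params n len [9, s, f1, f2, f3, f4, f5, f6]) ≤ Φ.dmax n := by
  obtain ⟨hFB, h2X, h2R, h2NN, h2N1, hXeq, hTF, hTFB, hLreq⟩ := Φ.param_facts n
  obtain ⟨⟨h30, hs, hb1, hb2, hb3, hb4, hb5, hb6, hlen, hNpos⟩, hr⟩ := (wf_SQ Φ).1 h
  obtain ⟨hr1, hr2, hr3, hr4⟩ := hr
  have hsz : Nat.size f1 ≤ Φ.F n + 1 := Φ.size_le_of_le_two_N hr2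
  rw [depth_SQ Φ h]
  unfold SuccIntMatrixFamily.dmax; omega

/-- The depth of `PSQ` is at most `dmax = 4F + 22`. [cite: KoiranPerifel2009VPSPACE, §3.2] -/
theorem dle_PSQ (h : WF Φ n len [10, s, f1, f2, f3, f4, f5, f6]) : depthX.eval (aenv Φ.params n len [10, s, f1, f2, f3, f4, f5, f6]) ≤ Φ.dmax n := by
  obtain ⟨hFB, h2X, h2R, h2NN, h2N1, hXeq, hTF, hTFB, hLreq⟩ := Φ.param_facts n
  obtain ⟨⟨h30, hs, hb1, hb2, hb3, hb4, hb5, hb6, hlen, hNpos⟩, hr⟩ := (wf_PSQ Φ).1 h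
  obtain ⟨hr1, hr2, hr3, hr4, hr5⟩ := hr
  have hsz : Nat.size f1 ≤ Φ.F n + 1 := Φ.size_le_of_le_two_N hr2
  rw [depth_PSQ Φ h]
  unfold SuccIntMatrixFamily.dmax; omega

/-- The depth of `PBP` is at most `dmax = 4F + 22`. [cite: KoiranPerifel2009VPSPACE, §3.2] -/
theorem dle_PBP (h : WF Φ n len [11, s, f1, f2, f3, f4, f5, f6]) : depthX.eval (aenv Φ.params n len [11, s, f1, f2, f3, f4, f5, f6]) ≤ Φ.dmax n := by
  obtain ⟨hFB, h2X, h2R, h2NN, h2N1, hXeq, hTF, hTFB, hLreq⟩ := Φ.param_facts n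
  obtain ⟨⟨h30, hs, hb1, hb2, hb3, hb4, hb5, hb6, hlen, hNpos⟩, hr⟩ := (wf_PBP Φ).1 h
  obtain ⟨hr1, hr2, hr3, hr4, hr5, hr6⟩ := hr
  have hsz : Nat.size f1 ≤ Φ.F n + 1 := Φ.size_le_of_le_two_N hr2
  rw [depth_PBP Φ h]
  unfold SuccIntMatrixFamily.dmax; omega

/-- The depth of `CSQ` is at most `dmax = 4F + 22`. [cite: KoiranPerifel2009VPSPACE, §3.2] -/
theorem dle_CSQ (h : WF Φ n len [12, s, f1, f2, f3, f4, f5, f6]) : depthX.eval (aenv Φ.params n len [12, s, f1, f2, f3, f4, f5, f6]) ≤ Φ.dmax n := by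
  obtain ⟨hFB, h2X, h2R, h2NN, h2N1, hXeq, hTF, hTFB, hLreq⟩ := Φ.param_facts n
  obtain ⟨⟨h30, hs, hb1, hb2, hb3, hb4, hb5, hb6, hlen, hNpos⟩, hr⟩ := (wf_CSQ Φ).1 h
  have hr1 := hr
  rw [depth_CSQ Φ h]
  unfold SuccIntMatrixFamily.dmax; omega

/-- The depth of `PC` is at most `dmax = 4F + 22`. [cite: KoiranPerifel2009VPSPACE, §3.2] -/
theorem dle_PC (h : WF Φ n len [13, s, f1, f2, f3, f4, f5, f6]) : depthX.eval (aenv Φ.params n len [13, s, f1, f2, f3, f4, f5, f6]) ≤ Φ.dmax n := by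
  obtain ⟨hFB, h2X, h2R, h2NN, h2N1, hXeq, hTF, hTFB, hLreq⟩ := Φ.param_facts n
  obtain ⟨⟨h30, hs, hb1, hb2, hb3, hb4, hb5, hb6, hlen, hNpos⟩, hr⟩ := (wf_PC Φ).1 h
  have hr1 := hr
  rw [depth_PC Φ h]
  unfold SuccIntMatrixFamily.dmax; omega

/-- The depth of `QK` is at most `dmax = 4F + 22`. [cite: KoiranPerifel2009VPSPACE, §3.2] -/
theorem dle_QK (h : WF Φ n len [14, s, f1, f2, f3, f4, f5, f6]) : depthX.eval (aenv Φ.params n len [14, s, f1, f2, f3, f4, f5, f6]) ≤ Φ.dmax n := by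
  obtain ⟨hFB, h2X, h2R, h2NN, h2N1, hXeq, hTF, hTFB, hLreq⟩ := Φ.param_facts n
  obtain ⟨⟨h30, hs, hb1, hb2, hb3, hb4, hb5, hb6, hlen, hNpos⟩, hr⟩ := (wf_QK Φ).1 h
  obtain ⟨hr1, hr2, hr3, hr4⟩ := hr
  rw [depth_QK Φ h]
  unfold SuccIntMatrixFamily.dmax; omega

/-- The depth of `PQK` is at most `dmax = 4F + 22`. [cite: KoiranPerifel2009VPSPACE, §3.2] -/
theorem dle_PQK (h : WF Φ n len [15, s, f1, f2, f3, f4, f5, f6]) : depthX.eval (aenv Φ.params n len [15, s, f1, f2, f3, f4, f5, f6]) ≤ Φ.dmax n := by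
  obtain ⟨hFB, h2X, h2R, h2NN, h2N1, hXeq, hTF, hTFB, hLreq⟩ := Φ.param_facts n
  obtain ⟨⟨h30, hs, hb1, hb2, hb3, hb4, hb5, hb6, hlen, hNpos⟩, hr⟩ := (wf_PQK Φ).1 h
  obtain ⟨hr1, hr2, hr3, hr4, hr5⟩ := hr
  rw [depth_PQK Φ h]
  unfold SuccIntMatrixFamily.dmax; omega

/-- The depth of `QT` is at most `dmax = 4F + 22`. [cite: KoiranPerifel2009VPSPACE, §3.2] -/
theorem dle_QT (h : WF Φ n len [16, s, f1, f2, f3, f4, f5, f6]) : depthX.eval (aenv Φ.params n len [16, s, f1, f2, f3, f4, f5, f6]) ≤ Φ.dmax n := by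
  obtain ⟨hFB, h2X, h2R, h2NN, h2N1, hXeq, hTF, hTFB, hLreq⟩ := Φ.param_facts n
  obtain ⟨⟨h30, hs, hb1, hb2, hb3, hb4, hb5, hb6, hlen, hNpos⟩, hr⟩ := (wf_QT Φ).1 h
  obtain ⟨hr1, hr2, hr3, hr4⟩ := hr
  rw [depth_QT Φ h]
  unfold SuccIntMatrixFamily.dmax; omega

/-- The depth of `QT2` is at most `dmax = 4F + 22`. [cite: KoiranPerifel2009VPSPACE, §3.2] -/
theorem dle_QT2 (h : WF Φ n len [17, s, f1, f2, f3, f4, f5, f6]) : depthX.eval (aenv Φ.params n len [17, s, f1, f2, f3, f4, f5, f6]) ≤ Φ.dmax n := by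
  obtain ⟨hFB, h2X, h2R, h2NN, h2N1, hXeq, hTF, hTFB, hLreq⟩ := Φ.param_facts n
  obtain ⟨⟨h30, hs, hb1, hb2, hb3, hb4, hb5, hb6, hlen, hNpos⟩, hr⟩ := (wf_QT2 Φ).1 h
  obtain ⟨hr1, hr2, hr3, hr4⟩ := hr
  rw [depth_QT2 Φ h]
  unfold SuccIntMatrixFamily.dmax; omega

/-- The depth of `QB` is at most `dmax = 4F + 22`. [cite: KoiranPerifel2009VPSPACE, §3.2] -/
theorem dle_QB (h : WF Φ n len [18, s, f1, f2, f3, f4, f5, f6]) : depthX.eval (aenv Φ.params n len [18, s, f1, f2, f3, f4, f5, f6]) ≤ Φ.dmax n := by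
  obtain ⟨hFB, h2X, h2R, h2NN, h2N1, hXeq, hTF, hTFB, hLreq⟩ := Φ.param_facts n
  obtain ⟨⟨h30, hs, hb1, hb2, hb3, hb4, hb5, hb6, hlen, hNpos⟩, hr⟩ := (wf_QB Φ).1 h
  obtain ⟨hr1, hr2, hr3⟩ := hr
  rw [depth_QB Φ h]
  unfold SuccIntMatrixFamily.dmax; omega

/-- The depth of `QSQ` is at most `dmax = 4F + 22`. [cite: KoiranPerifel2009VPSPACE, §3.2] -/
theorem dle_QSQ (h : WF Φ n len [19, s, f1, f2, f3, f4, f5, f6]) : depthX.eval (aenv Φ.params n len [19, s, f1, f2, f3, f4, f5, f6]) ≤ Φ.dmax n := by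
  obtain ⟨hFB, h2X, h2R, h2NN, h2N1, hXeq, hTF, hTFB, hLreq⟩ := Φ.param_facts n
  obtain ⟨⟨h30, hs, hb1, hb2, hb3, hb4, hb5, hb6, hlen, hNpos⟩, hr⟩ := (wf_QSQ Φ).1 h
  have hr1 := hr
  rw [depth_QSQ Φ h]
  unfold SuccIntMatrixFamily.dmax; omega

/-- The depth of `PQ` is at most `dmax = 4F + 22`. [cite: KoiranPerifel2009VPSPACE, §3.2] -/
theorem dle_PQ (h : WF Φ n len [20, s, f1, f2, f3, f4, f5, f6]) : depthX.eval (aenv Φ.params n len [20, s, f1, f2, f3, f4, f5, f6]) ≤ Φ.dmax n := by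
  obtain ⟨hFB, h2X, h2R, h2NN, h2N1, hXeq, hTF, hTFB, hLreq⟩ := Φ.param_facts n
  obtain ⟨⟨h30, hs, hb1, hb2, hb3, hb4, hb5, hb6, hlen, hNpos⟩, hr⟩ := (wf_PQ Φ).1 h
  obtain ⟨hr1, hr2⟩ := hr
  rw [depth_PQ Φ h]
  unfold SuccIntMatrixFamily.dmax; omega

/-- The depth of `NT` is at most `dmax = 4F + 22`. [cite: KoiranPerifel2009VPSPACE, §3.2] -/
theorem dle_NT (h : WF Φ n len [21, s, f1, f2, f3, f4, f5, f6]) : depthX.eval (aenv Φ.params n len [21, s, f1, f2, f3, f4, f5, f6]) ≤ Φ.dmax n := by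
  obtain ⟨hFB, h2X, h2R, h2NN, h2N1, hXeq, hTF, hTFB, hLreq⟩ := Φ.param_facts n
  obtain ⟨⟨h30, hs, hb1, hb2, hb3, hb4, hb5, hb6, hlen, hNpos⟩, hr⟩ := (wf_NT Φ).1 h
  obtain ⟨hr1, hr2, hr3⟩ := hr
  rw [depth_NT Φ h]
  unfold SuccIntMatrixFamily.dmax; omega

/-- The depth of `NT2` is at most `dmax = 4F + 22`. [cite: KoiranPerifel2009VPSPACE, §3.2] -/
theorem dle_NT2 (h : WF Φ n len [22, s, f1, f2, f3, f4, f5, f6]) : depthX.eval (aenv Φ.params n len [22, s, f1, f2, f3, f4, f5, f6]) ≤ Φ.dmax n := by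
  obtain ⟨hFB, h2X, h2R, h2NN, h2N1, hXeq, hTF, hTFB, hLreq⟩ := Φ.param_facts n
  obtain ⟨⟨h30, hs, hb1, hb2, hb3, hb4, hb5, hb6, hlen, hNpos⟩, hr⟩ := (wf_NT2 Φ).1 h
  obtain ⟨hr1, hr2, hr3⟩ := hr
  rw [depth_NT2 Φ h]
  unfold SuccIntMatrixFamily.dmax; omega

/-- The depth of `NB` is at most `dmax = 4F + 22`. [cite: KoiranPerifel2009VPSPACE, §3.2] -/
theorem dle_NB (h : WF Φ n len [23, s, f1, f2, f3, f4, f5, f6]) : depthX.eval (aenv Φ.params n len [23, s, f1, f2, f3, f4, f5, f6]) ≤ Φ.dmax n := by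
  obtain ⟨hFB, h2X, h2R, h2NN, h2N1, hXeq, hTF, hTFB, hLreq⟩ := Φ.param_facts n
  obtain ⟨⟨h30, hs, hb1, hb2, hb3, hb4, hb5, hb6, hlen, hNpos⟩, hr⟩ := (wf_NB Φ).1 h
  obtain ⟨hr1, hr2⟩ := hr
  rw [depth_NB Φ h]
  unfold SuccIntMatrixFamily.dmax; omega

/-- The depth of `COLSQ` is at most `dmax = 4F + 22`. [cite: KoiranPerifel2009VPSPACE, §3.2] -/
theorem dle_COLSQ (h : WF Φ n len [24, s, f1, f2, f3, f4, f5, f6]) : depthX.eval (aenv Φ.params n len [24, s, f1, f2, f3, f4, f5, f6]) ≤ Φ.dmax n := by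
  obtain ⟨hFB, h2X, h2R, h2NN, h2N1, hXeq, hTF, hTFB, hLreq⟩ := Φ.param_facts n
  obtain ⟨⟨h30, hs, hb1, hb2, hb3, hb4, hb5, hb6, hlen, hNpos⟩, hr⟩ := (wf_COLSQ Φ).1 h
  have hr1 := hr
  rw [depth_COLSQ Φ h]
  unfold SuccIntMatrixFamily.dmax; omega

/-- The depth of `PN` is at most `dmax = 4F + 22`. [cite: KoiranPerifel2009VPSPACE, §3.2] -/
theorem dle_PN (h : WF Φ n len [25, s, f1, f2, f3, f4, f5, f6]) : depthX.eval (aenv Φ.params n len [25, s, f1, f2, f3, f4, f5, f6]) ≤ Φ.dmax n := by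
  obtain ⟨hFB, h2X, h2R, h2NN, h2N1, hXeq, hTF, hTFB, hLreq⟩ := Φ.param_facts n
  obtain ⟨⟨h30, hs, hb1, hb2, hb3, hb4, hb5, hb6, hlen, hNpos⟩, hr⟩ := (wf_PN Φ).1 h
  obtain ⟨hr1, hr2⟩ := hr
  rw [depth_PN Φ h]
  unfold SuccIntMatrixFamily.dmax; omega

/-- The depth of `PRE` is at most `dmax = 4F + 22`. [cite: KoiranPerifel2009VPSPACE, §3.2] -/
theorem dle_PRE (h : WF Φ n len [26, s, f1, f2, f3, f4, f5, f6]) : depthX.eval (aenv Φ.params n len [26, s, f1, f2, f3, f4, f5, f6]) ≤ Φ.dmax n := by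
  obtain ⟨hFB, h2X, h2R, h2NN, h2N1, hXeq, hTF, hTFB, hLreq⟩ := Φ.param_facts n
  obtain ⟨⟨h30, hs, hb1, hb2, hb3, hb4, hb5, hb6, hlen, hNpos⟩, hr⟩ := (wf_PRE Φ).1 h
  have hr1 := hr
  rw [depth_PRE Φ h]
  unfold SuccIntMatrixFamily.dmax; omega

/-- The depth of `VT` is at most `dmax = 4F + 22`. [cite: KoiranPerifel2009VPSPACE, §3.2] -/
theorem dle_VT (h : WF Φ n len [27, s, f1, f2, f3, f4, f5, f6]) : depthX.eval (aenv Φ.params n len [27, s, f1, f2, f3, f4, f5, f6]) ≤ Φ.dmax n := by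
  obtain ⟨hFB, h2X, h2R, h2NN, h2N1, hXeq, hTF, hTFB, hLreq⟩ := Φ.param_facts n
  obtain ⟨⟨h30, hs, hb1, hb2, hb3, hb4, hb5, hb6, hlen, hNpos⟩, hr⟩ := (wf_VT Φ).1 h
  obtain ⟨hr1, hr2⟩ := hr
  rw [depth_VT Φ h]
  unfold SuccIntMatrixFamily.dmax; omega

/-- The depth of `VT2` is at most `dmax = 4F + 22`. [cite: KoiranPerifel2009VPSPACE, §3.2] -/
theorem dle_VT2 (h : WF Φ n len [28, s, f1, f2, f3, f4, f5, f6]) : depthX.eval (aenv Φ.params n len [28, s, f1, f2, f3, f4, f5, f6]) ≤ Φ.dmax n := by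
  obtain ⟨hFB, h2X, h2R, h2NN, h2N1, hXeq, hTF, hTFB, hLreq⟩ := Φ.param_facts n
  obtain ⟨⟨h30, hs, hb1, hb2, hb3, hb4, hb5, hb6, hlen, hNpos⟩, hr⟩ := (wf_VT2 Φ).1 h
  obtain ⟨hr1, hr2⟩ := hr
  rw [depth_VT2 Φ h]
  unfold SuccIntMatrixFamily.dmax; omega

/-- The depth of `V` is at most `dmax = 4F + 22`. [cite: KoiranPerifel2009VPSPACE, §3.2] -/
theorem dle_V (h : WF Φ n len [29, s, f1, f2, f3, f4, f5, f6]) : depthX.eval (aenv Φ.params n len [29, s, f1, f2, f3, f4, f5, f6]) ≤ Φ.dmax n := by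
  obtain ⟨hFB, h2X, h2R, h2NN, h2N1, hXeq, hTF, hTFB, hLreq⟩ := Φ.param_facts n
  obtain ⟨⟨h30, hs, hb1, hb2, hb3, hb4, hb5, hb6, hlen, hNpos⟩, hr⟩ := (wf_V Φ).1 h
  have hr1 := hr
  rw [depth_V Φ h]
  unfold SuccIntMatrixFamily.dmax; omega

/-- The depth of `ZERO` is at most `dmax = 4F + 22`. [cite: KoiranPerifel2009VPSPACE, §3.2] -/
theorem dle_ZERO (h : WF Φ n len [30, s, f1, f2, f3, f4, f5, f6]) : depthX.eval (aenv Φ.params n len [30, s, f1, f2, f3, f4, f5, f6]) ≤ Φ.dmax n := by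
  obtain ⟨hFB, h2X, h2R, h2NN, h2N1, hXeq, hTF, hTFB, hLreq⟩ := Φ.param_facts n
  obtain ⟨⟨h30, hs, hb1, hb2, hb3, hb4, hb5, hb6, hlen, hNpos⟩, hr⟩ := (wf_ZERO Φ).1 h
  rw [depth_ZERO Φ h]
  unfold SuccIntMatrixFamily.dmax; omega


/-! #### Hand-written steps: the select-by-decoding gate `M`, the power gate `P`, the binary power `BP` -/

/-- `mRowL_lt` (plumbing). [cite: AroraBarak2009, §1.3 (polynomial-time arithmetic on binary numerals)] -/
theorem mRowL_lt {n : ℕ} (x y : ℕ) (hN : 0 < Φ.N n) : mRowL Φ n x y < Φ.N n := by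
  unfold mRowL
  split_ifs <;> first | exact Nat.mod_lt _ hN | omega

/-- `mColL_lt` (plumbing). [cite: AroraBarak2009, §1.3 (polynomial-time arithmetic on binary numerals)] -/
theorem mColL_lt {n : ℕ} (x y : ℕ) (hN : 0 < Φ.N n) : mColL Φ n x y < Φ.N n := by
  unfold mColL
  split_ifs <;> first | exact Nat.mod_lt _ hN | omega

/-- Children of `M`: they fit, and they are shallower. [cite: KoiranPerifel2009VPSPACE, §3.2] -/
theorem step_M (h : WF Φ n len [4, s, f1, f2, f3, f4, f5, f6]) (k : ℕ)
    (hk : k < gateFanIn (kindX.eval (aenv Φ.params n len [4, s, f1, f2, f3, f4, f5, f6]))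
      (arityX.eval (aenv Φ.params n len [4, s, f1, f2, f3, f4, f5, f6]))) :
    (gcore n (childX.map (AExp.eval (aenvK Φ.params n len [4, s, f1, f2, f3, f4, f5, f6] k)))).length ≤ len ∧
    WF Φ n len (childX.map (AExp.eval (aenvK Φ.params n len [4, s, f1, f2, f3, f4, f5, f6] k))) ∧
    depthX.eval (aenv Φ.params n len (childX.map (AExp.eval (aenvK Φ.params n len [4, s, f1, f2, f3, f4, f5, f6] k)))) <
      depthX.eval (aenv Φ.params n len [4, s, f1, f2, f3, f4, f5, f6]) := by
  obtain ⟨hFB, h2X, h2R, h2NN, h2N1, hXeq, hTF, hTFB, hLreq⟩ := Φ.param_facts n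
  obtain ⟨⟨h30, hs, hb1, hb2, hb3, hb4, hb5, hb6, hlen, hNpos⟩, hr⟩ := (wf_M Φ).1 h
  have hrow := mRowL_lt Φ f1 f2 hNpos
  have hcol := mColL_lt Φ f1 f2 hNpos
  have hN1 : Φ.N n < Φ.FB n := by omega
  rw [kind_M Φ h, arity_M Φ h] at hk
  rw [child_M, depth_M Φ h]
  simp only [gateFanIn, if_true] at hk
  by_cases h1 : mKapL Φ n f1 f2 = 1
  · simp only [h1, if_true] at hk ⊢
    have hk0 : k = 0 := by split_ifs at hk <;> omega
    have hw' := (wf_ONE Φ (n := n) (len := len) (s := 0) (f1 := 0) (f2 := 0) (f3 := 0) (f4 := 0) (f5 := 0)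
      (f6 := 0)).2 ⟨⟨by omega, by omega, by omega, by omega, by omega, by omega, by omega, by omega, hlen, hNpos⟩, trivial⟩
    refine ⟨fits8 Φ (by omega) (by omega) (by omega) (by omega) (by omega) (by omega) (by omega) (by omega) hlen, hw', ?_⟩
    rw [depth_ONE Φ hw']
    omega
  · simp only [h1, if_false] at hk ⊢
    have h34 : mKapL Φ n f1 f2 = 3 ∨ mKapL Φ n f1 f2 = 4 := by
      by_contra hc; rw [not_or] at hc; rw [if_neg hc.1, if_neg hc.2] at hk; omega
    have hs' : (if mKapL Φ n f1 f2 = 3 then s else 1 - s) ≤ 1 := by split_ifs <;> omega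
    have hw' := (wf_B Φ (n := n) (len := len) (s := if mKapL Φ n f1 f2 = 3 then s else 1 - s)
      (f1 := mRowL Φ n f1 f2) (f2 := mColL Φ n f1 f2) (f3 := 0) (f4 := 0) (f5 := 0) (f6 := 0)).2
      ⟨⟨by omega, hs', by omega, by omega, by omega, by omega, by omega, by omega, hlen, hNpos⟩, hrow, hcol⟩
    refine ⟨fits8 Φ (by omega) (by omega) (by omega) (by omega) (by omega) (by omega) (by omega) (by omega) hlen, hw', ?_⟩
    rw [depth_B Φ hw']
    omega

/-- Children of `P`: they fit, and they are shallower. [cite: KoiranPerifel2009VPSPACE, §3.2] -/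
theorem step_P (h : WF Φ n len [5, s, f1, f2, f3, f4, f5, f6]) (k : ℕ)
    (hk : k < gateFanIn (kindX.eval (aenv Φ.params n len [5, s, f1, f2, f3, f4, f5, f6]))
      (arityX.eval (aenv Φ.params n len [5, s, f1, f2, f3, f4, f5, f6]))) :
    (gcore n (childX.map (AExp.eval (aenvK Φ.params n len [5, s, f1, f2, f3, f4, f5, f6] k)))).length ≤ len ∧
    WF Φ n len (childX.map (AExp.eval (aenvK Φ.params n len [5, s, f1, f2, f3, f4, f5, f6] k))) ∧
    depthX.eval (aenv Φ.params n len (childX.map (AExp.eval (aenvK Φ.params n len [5, s, f1, f2, f3, f4, f5, f6] k)))) <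
      depthX.eval (aenv Φ.params n len [5, s, f1, f2, f3, f4, f5, f6]) := by
  obtain ⟨hFB, h2X, h2R, h2NN, h2N1, hXeq, hTF, hTFB, hLreq⟩ := Φ.param_facts n
  obtain ⟨⟨h30, hs, hb1, hb2, hb3, hb4, hb5, hb6, hlen, hNpos⟩, hr⟩ := (wf_P Φ).1 h
  obtain ⟨hr1, hr2, hr3⟩ := hr
  rw [kind_P Φ h, arity_P Φ h] at hk
  rw [child_P, depth_P Φ h]
  simp only [gateFanIn, if_true] at hk
  rcases Nat.eq_zero_or_pos f1 with h0 | hpos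
  · subst h0
    simp only [if_true] at hk ⊢
    have hw' := (wf_M Φ (n := n) (len := len) (s := s) (f1 := f2) (f2 := f3) (f3 := 0) (f4 := 0) (f5 := 0)
      (f6 := 0)).2 ⟨⟨by omega, hs, by omega, by omega, by omega, by omega, by omega, by omega, hlen, hNpos⟩, hr2, hr3⟩
    refine ⟨fits8 Φ (by omega) (by omega) (by omega) (by omega) (by omega) (by omega) (by omega) (by omega) hlen, hw', ?_⟩
    rw [depth_M Φ hw']
    omega
  · have hne : f1 ≠ 0 := Nat.pos_iff_ne_zero.1 hpos
    simp only [hne, if_false] at hk ⊢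
    have hw' := (wf_PP Φ (n := n) (len := len) (s := s) (f1 := f1) (f2 := f2) (f3 := f3) (f4 := k) (f5 := 0)
      (f6 := 0)).2 ⟨⟨by omega, hs, by omega, by omega, by omega, by omega, by omega, by omega, hlen, hNpos⟩,
        hpos, hr1, hr2, hr3, hk⟩
    refine ⟨fits8 Φ (by omega) (by omega) (by omega) (by omega) (by omega) (by omega) (by omega) (by omega) hlen, hw', ?_⟩
    rw [depth_PP Φ hw']
    omega

/-- Children of `BP`: they fit, and they are shallower. [cite: KoiranPerifel2009VPSPACE, §3.2] -/
theorem step_BP (h : WF Φ n len [8, s, f1, f2, f3, f4, f5, f6]) (k : ℕ)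
    (hk : k < gateFanIn (kindX.eval (aenv Φ.params n len [8, s, f1, f2, f3, f4, f5, f6]))
      (arityX.eval (aenv Φ.params n len [8, s, f1, f2, f3, f4, f5, f6]))) :
    (gcore n (childX.map (AExp.eval (aenvK Φ.params n len [8, s, f1, f2, f3, f4, f5, f6] k)))).length ≤ len ∧
    WF Φ n len (childX.map (AExp.eval (aenvK Φ.params n len [8, s, f1, f2, f3, f4, f5, f6] k))) ∧
    depthX.eval (aenv Φ.params n len (childX.map (AExp.eval (aenvK Φ.params n len [8, s, f1, f2, f3, f4, f5, f6] k)))) <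
      depthX.eval (aenv Φ.params n len [8, s, f1, f2, f3, f4, f5, f6]) := by
  obtain ⟨hFB, h2X, h2R, h2NN, h2N1, hXeq, hTF, hTFB, hLreq⟩ := Φ.param_facts n
  obtain ⟨⟨h30, hs, hb1, hb2, hb3, hb4, hb5, hb6, hlen, hNpos⟩, hr⟩ := (wf_BP Φ).1 h
  obtain ⟨hr1, hr2, hr3⟩ := hr
  rw [kind_BP Φ h, arity_BP Φ h] at hk
  rw [child_BP, depth_BP Φ h]
  simp only [gateFanIn, if_true] at hk
  rcases Nat.eq_zero_or_pos f1 with h0 | hpos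
  · subst h0
    simp only [if_true, Nat.size_zero] at hk ⊢
    have hw' := (wf_ONE Φ (n := n) (len := len) (s := 0) (f1 := 0) (f2 := 0) (f3 := 0) (f4 := 0) (f5 := 0)
      (f6 := 0)).2 ⟨⟨by omega, by omega, by omega, by omega, by omega, by omega, by omega, by omega, hlen, hNpos⟩, trivial⟩
    refine ⟨fits8 Φ (by omega) (by omega) (by omega) (by omega) (by omega) (by omega) (by omega) (by omega) hlen, hw', ?_⟩
    rw [depth_ONE Φ hw']
    omega
  · have hne : f1 ≠ 0 := Nat.pos_iff_ne_zero.1 hpos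
    simp only [hne, if_false] at hk ⊢
    by_cases hev : f1 % 2 = 0
    · simp only [hev, if_true] at hk ⊢
      have hw' := (wf_SQ Φ (n := n) (len := len) (s := s) (f1 := f1) (f2 := f2) (f3 := f3) (f4 := 0) (f5 := 0)
        (f6 := 0)).2 ⟨⟨by omega, hs, by omega, by omega, by omega, by omega, by omega, by omega, hlen, hNpos⟩,
          hpos, hr1, hr2, hr3⟩
      refine ⟨fits8 Φ (by omega) (by omega) (by omega) (by omega) (by omega) (by omega) (by omega) (by omega) hlen, hw', ?_⟩
      rw [depth_SQ Φ hw']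
      omega
    · simp only [hev, if_false] at hk ⊢
      have hw' := (wf_PBP Φ (n := n) (len := len) (s := s) (f1 := f1) (f2 := f2) (f3 := f3) (f4 := k) (f5 := 0)
        (f6 := 0)).2 ⟨⟨by omega, hs, by omega, by omega, by omega, by omega, by omega, by omega, hlen, hNpos⟩,
          hpos, hr1, by omega, hr2, hr3, hk⟩
      refine ⟨fits8 Φ (by omega) (by omega) (by omega) (by omega) (by omega) (by omega) (by omega) (by omega) hlen, hw', ?_⟩
      rw [depth_PBP Φ hw']
      omega

/-! #### All tags -/

/-- **Every child of a well-formed tuple fits in the name and is shallower.** [cite: KoiranPerifel2009VPSPACE, §3.2] -/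
theorem step_all {t : List ℕ} (ht : t.length = 8) (h : WF Φ n len t) (k : ℕ)
    (hk : k < gateFanIn (kindX.eval (aenv Φ.params n len t)) (arityX.eval (aenv Φ.params n len t))) :
    (gcore n (childX.map (AExp.eval (aenvK Φ.params n len t k)))).length ≤ len ∧
    WF Φ n len (childX.map (AExp.eval (aenvK Φ.params n len t k))) ∧
    depthX.eval (aenv Φ.params n len (childX.map (AExp.eval (aenvK Φ.params n len t k)))) <
      depthX.eval (aenv Φ.params n len t) := by
  obtain ⟨a0, s, f1, f2, f3, f4, f5, f6, rfl⟩ := exists_eq_eight ht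
  have ha : a0 ≤ 30 := h.1.1
  interval_cases a0
  · exact step_ONE Φ h k hk
  · exact step_A Φ h k hk
  · exact step_B Φ h k hk
  · exact step_PA Φ h k hk
  · exact step_M Φ h k hk
  · exact step_P Φ h k hk
  · exact step_PP Φ h k hk
  · exact step_C Φ h k hk
  · exact step_BP Φ h k hk
  · exact step_SQ Φ h k hk
  · exact step_PSQ Φ h k hk
  · exact step_PBP Φ h k hk
  · exact step_CSQ Φ h k hk
  · exact step_PC Φ h k hk
  · exact step_QK Φ h k hk
  · exact step_PQK Φ h k hk
  · exact step_QT Φ h k hk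
  · exact step_QT2 Φ h k hk
  · exact step_QB Φ h k hk
  · exact step_QSQ Φ h k hk
  · exact step_PQ Φ h k hk
  · exact step_NT Φ h k hk
  · exact step_NT2 Φ h k hk
  · exact step_NB Φ h k hk
  · exact step_COLSQ Φ h k hk
  · exact step_PN Φ h k hk
  · exact step_PRE Φ h k hk
  · exact step_VT Φ h k hk
  · exact step_VT2 Φ h k hk
  · exact step_V Φ h k hk
  · exact step_ZERO Φ h k hk

/-- **Every well-formed tuple has depth at most `dmax = 4F + 22`.** [cite: KoiranPerifel2009VPSPACE, §3.2] -/
theorem dle_all {t : List ℕ} (ht : t.length = 8) (h : WF Φ n len t) :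
    depthX.eval (aenv Φ.params n len t) ≤ Φ.dmax n := by
  obtain ⟨a0, s, f1, f2, f3, f4, f5, f6, rfl⟩ := exists_eq_eight ht
  have ha : a0 ≤ 30 := h.1.1
  interval_cases a0
  · exact dle_ONE Φ h
  · exact dle_A Φ h
  · exact dle_B Φ h
  · exact dle_PA Φ h
  · exact dle_M Φ h
  · exact dle_P Φ h
  · exact dle_PP Φ h
  · exact dle_C Φ h
  · exact dle_BP Φ h
  · exact dle_SQ Φ h
  · exact dle_PSQ Φ h
  · exact dle_PBP Φ h
  · exact dle_CSQ Φ h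
  · exact dle_PC Φ h
  · exact dle_QK Φ h
  · exact dle_PQK Φ h
  · exact dle_QT Φ h
  · exact dle_QT2 Φ h
  · exact dle_QB Φ h
  · exact dle_QSQ Φ h
  · exact dle_PQ Φ h
  · exact dle_NT Φ h
  · exact dle_NT2 Φ h
  · exact dle_NB Φ h
  · exact dle_COLSQ Φ h
  · exact dle_PN Φ h
  · exact dle_PRE Φ h
  · exact dle_VT Φ h
  · exact dle_VT2 Φ h
  · exact dle_V Φ h
  · exact dle_ZERO Φ h

/-- Width bound for `ONE` as a constant gate. [cite: KoiranPerifel2009VPSPACE, §3.2] -/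
theorem wbound_ONE (h : WF Φ n len [0, s, f1, f2, f3, f4, f5, f6]) (_h1 : kindX.eval (aenv Φ.params n len [0, s, f1, f2, f3, f4, f5, f6]) ≠ 1)
    (_h2 : kindX.eval (aenv Φ.params n len [0, s, f1, f2, f3, f4, f5, f6]) ≠ 2) (_h3 : kindX.eval (aenv Φ.params n len [0, s, f1, f2, f3, f4, f5, f6]) ≠ 3) :
    widthX.eval (aenv Φ.params n len [0, s, f1, f2, f3, f4, f5, f6]) ≤ Φ.W₀ n + 1 := by
  rw [width_ONE Φ h]; omega

/-- Arity bound for `ONE` as a sum gate. [cite: KoiranPerifel2009VPSPACE, §3.2] -/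
theorem abound_ONE (h : WF Φ n len [0, s, f1, f2, f3, f4, f5, f6]) (h1 : kindX.eval (aenv Φ.params n len [0, s, f1, f2, f3, f4, f5, f6]) = 1) :
    arityX.eval (aenv Φ.params n len [0, s, f1, f2, f3, f4, f5, f6]) ≤ Φ.FB n := by
  exfalso; rw [kind_ONE Φ h] at h1; exact absurd h1 (by norm_num)

/-- Width bound for `A` as a constant gate. [cite: KoiranPerifel2009VPSPACE, §3.2] -/
theorem wbound_A (h : WF Φ n len [1, s, f1, f2, f3, f4, f5, f6]) (_h1 : kindX.eval (aenv Φ.params n len [1, s, f1, f2, f3, f4, f5, f6]) ≠ 1)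
    (_h2 : kindX.eval (aenv Φ.params n len [1, s, f1, f2, f3, f4, f5, f6]) ≠ 2) (_h3 : kindX.eval (aenv Φ.params n len [1, s, f1, f2, f3, f4, f5, f6]) ≠ 3) :
    widthX.eval (aenv Φ.params n len [1, s, f1, f2, f3, f4, f5, f6]) ≤ Φ.W₀ n + 1 := by
  rw [width_A Φ h]; omega

/-- Arity bound for `A` as a sum gate. [cite: KoiranPerifel2009VPSPACE, §3.2] -/
theorem abound_A (h : WF Φ n len [1, s, f1, f2, f3, f4, f5, f6]) (h1 : kindX.eval (aenv Φ.params n len [1, s, f1, f2, f3, f4, f5, f6]) = 1) :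
    arityX.eval (aenv Φ.params n len [1, s, f1, f2, f3, f4, f5, f6]) ≤ Φ.FB n := by
  exfalso; rw [kind_A Φ h] at h1; exact absurd h1 (by norm_num)

/-- Width bound for `B` as a constant gate. [cite: KoiranPerifel2009VPSPACE, §3.2] -/
theorem wbound_B (h : WF Φ n len [2, s, f1, f2, f3, f4, f5, f6]) (h1 : kindX.eval (aenv Φ.params n len [2, s, f1, f2, f3, f4, f5, f6]) ≠ 1)
    (_h2 : kindX.eval (aenv Φ.params n len [2, s, f1, f2, f3, f4, f5, f6]) ≠ 2) (_h3 : kindX.eval (aenv Φ.params n len [2, s, f1, f2, f3, f4, f5, f6]) ≠ 3) :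
    widthX.eval (aenv Φ.params n len [2, s, f1, f2, f3, f4, f5, f6]) ≤ Φ.W₀ n + 1 := by
  exfalso; rw [kind_B Φ h] at h1; exact h1 rfl

/-- Arity bound for `B` as a sum gate. [cite: KoiranPerifel2009VPSPACE, §3.2] -/
theorem abound_B (h : WF Φ n len [2, s, f1, f2, f3, f4, f5, f6]) (_h1 : kindX.eval (aenv Φ.params n len [2, s, f1, f2, f3, f4, f5, f6]) = 1) :
    arityX.eval (aenv Φ.params n len [2, s, f1, f2, f3, f4, f5, f6]) ≤ Φ.FB n := by
  obtain ⟨hFB, h2X, h2R, h2NN, h2N1, hXeq, hTF, hTFB, hLreq⟩ := Φ.param_facts n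
  obtain ⟨⟨h30, hs, hb1, hb2, hb3, hb4, hb5, hb6, hlen, hNpos⟩, hr⟩ := (wf_B Φ).1 h
  rw [arity_B Φ h]
  omega

/-- Width bound for `PA` as a constant gate. [cite: KoiranPerifel2009VPSPACE, §3.2] -/
theorem wbound_PA (h : WF Φ n len [3, s, f1, f2, f3, f4, f5, f6]) (_h1 : kindX.eval (aenv Φ.params n len [3, s, f1, f2, f3, f4, f5, f6]) ≠ 1)
    (h2 : kindX.eval (aenv Φ.params n len [3, s, f1, f2, f3, f4, f5, f6]) ≠ 2) (_h3 : kindX.eval (aenv Φ.params n len [3, s, f1, f2, f3, f4, f5, f6]) ≠ 3) :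
    widthX.eval (aenv Φ.params n len [3, s, f1, f2, f3, f4, f5, f6]) ≤ Φ.W₀ n + 1 := by
  exfalso; rw [kind_PA Φ h] at h2; exact h2 rfl

/-- Arity bound for `PA` as a sum gate. [cite: KoiranPerifel2009VPSPACE, §3.2] -/
theorem abound_PA (h : WF Φ n len [3, s, f1, f2, f3, f4, f5, f6]) (h1 : kindX.eval (aenv Φ.params n len [3, s, f1, f2, f3, f4, f5, f6]) = 1) :
    arityX.eval (aenv Φ.params n len [3, s, f1, f2, f3, f4, f5, f6]) ≤ Φ.FB n := by
  exfalso; rw [kind_PA Φ h] at h1; exact absurd h1 (by norm_num)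

/-- Width bound for `M` as a constant gate. [cite: KoiranPerifel2009VPSPACE, §3.2] -/
theorem wbound_M (h : WF Φ n len [4, s, f1, f2, f3, f4, f5, f6]) (h1 : kindX.eval (aenv Φ.params n len [4, s, f1, f2, f3, f4, f5, f6]) ≠ 1)
    (_h2 : kindX.eval (aenv Φ.params n len [4, s, f1, f2, f3, f4, f5, f6]) ≠ 2) (_h3 : kindX.eval (aenv Φ.params n len [4, s, f1, f2, f3, f4, f5, f6]) ≠ 3) :
    widthX.eval (aenv Φ.params n len [4, s, f1, f2, f3, f4, f5, f6]) ≤ Φ.W₀ n + 1 := by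
  exfalso; rw [kind_M Φ h] at h1; exact h1 rfl

/-- Arity bound for `M` as a sum gate. [cite: KoiranPerifel2009VPSPACE, §3.2] -/
theorem abound_M (h : WF Φ n len [4, s, f1, f2, f3, f4, f5, f6]) (_h1 : kindX.eval (aenv Φ.params n len [4, s, f1, f2, f3, f4, f5, f6]) = 1) :
    arityX.eval (aenv Φ.params n len [4, s, f1, f2, f3, f4, f5, f6]) ≤ Φ.FB n := by
  obtain ⟨hFB, h2X, h2R, h2NN, h2N1, hXeq, hTF, hTFB, hLreq⟩ := Φ.param_facts n
  obtain ⟨⟨h30, hs, hb1, hb2, hb3, hb4, hb5, hb6, hlen, hNpos⟩, hr⟩ := (wf_M Φ).1 h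
  rw [arity_M Φ h]
  split_ifs <;> omega

/-- Width bound for `P` as a constant gate. [cite: KoiranPerifel2009VPSPACE, §3.2] -/
theorem wbound_P (h : WF Φ n len [5, s, f1, f2, f3, f4, f5, f6]) (h1 : kindX.eval (aenv Φ.params n len [5, s, f1, f2, f3, f4, f5, f6]) ≠ 1)
    (_h2 : kindX.eval (aenv Φ.params n len [5, s, f1, f2, f3, f4, f5, f6]) ≠ 2) (_h3 : kindX.eval (aenv Φ.params n len [5, s, f1, f2, f3, f4, f5, f6]) ≠ 3) :
    widthX.eval (aenv Φ.params n len [5, s, f1, f2, f3, f4, f5, f6]) ≤ Φ.W₀ n + 1 := by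
  exfalso; rw [kind_P Φ h] at h1; exact h1 rfl

/-- Arity bound for `P` as a sum gate. [cite: KoiranPerifel2009VPSPACE, §3.2] -/
theorem abound_P (h : WF Φ n len [5, s, f1, f2, f3, f4, f5, f6]) (_h1 : kindX.eval (aenv Φ.params n len [5, s, f1, f2, f3, f4, f5, f6]) = 1) :
    arityX.eval (aenv Φ.params n len [5, s, f1, f2, f3, f4, f5, f6]) ≤ Φ.FB n := by
  obtain ⟨hFB, h2X, h2R, h2NN, h2N1, hXeq, hTF, hTFB, hLreq⟩ := Φ.param_facts n
  obtain ⟨⟨h30, hs, hb1, hb2, hb3, hb4, hb5, hb6, hlen, hNpos⟩, hr⟩ := (wf_P Φ).1 h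
  rw [arity_P Φ h]
  split_ifs <;> omega

/-- Width bound for `PP` as a constant gate. [cite: KoiranPerifel2009VPSPACE, §3.2] -/
theorem wbound_PP (h : WF Φ n len [6, s, f1, f2, f3, f4, f5, f6]) (_h1 : kindX.eval (aenv Φ.params n len [6, s, f1, f2, f3, f4, f5, f6]) ≠ 1)
    (h2 : kindX.eval (aenv Φ.params n len [6, s, f1, f2, f3, f4, f5, f6]) ≠ 2) (_h3 : kindX.eval (aenv Φ.params n len [6, s, f1, f2, f3, f4, f5, f6]) ≠ 3) :
    widthX.eval (aenv Φ.params n len [6, s, f1, f2, f3, f4, f5, f6]) ≤ Φ.W₀ n + 1 := by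
  exfalso; rw [kind_PP Φ h] at h2; exact h2 rfl

/-- Arity bound for `PP` as a sum gate. [cite: KoiranPerifel2009VPSPACE, §3.2] -/
theorem abound_PP (h : WF Φ n len [6, s, f1, f2, f3, f4, f5, f6]) (h1 : kindX.eval (aenv Φ.params n len [6, s, f1, f2, f3, f4, f5, f6]) = 1) :
    arityX.eval (aenv Φ.params n len [6, s, f1, f2, f3, f4, f5, f6]) ≤ Φ.FB n := by
  exfalso; rw [kind_PP Φ h] at h1; exact absurd h1 (by norm_num)

/-- Width bound for `C` as a constant gate. [cite: KoiranPerifel2009VPSPACE, §3.2] -/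
theorem wbound_C (h : WF Φ n len [7, s, f1, f2, f3, f4, f5, f6]) (h1 : kindX.eval (aenv Φ.params n len [7, s, f1, f2, f3, f4, f5, f6]) ≠ 1)
    (_h2 : kindX.eval (aenv Φ.params n len [7, s, f1, f2, f3, f4, f5, f6]) ≠ 2) (_h3 : kindX.eval (aenv Φ.params n len [7, s, f1, f2, f3, f4, f5, f6]) ≠ 3) :
    widthX.eval (aenv Φ.params n len [7, s, f1, f2, f3, f4, f5, f6]) ≤ Φ.W₀ n + 1 := by
  exfalso; rw [kind_C Φ h] at h1; exact h1 rfl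

/-- Arity bound for `C` as a sum gate. [cite: KoiranPerifel2009VPSPACE, §3.2] -/
theorem abound_C (h : WF Φ n len [7, s, f1, f2, f3, f4, f5, f6]) (_h1 : kindX.eval (aenv Φ.params n len [7, s, f1, f2, f3, f4, f5, f6]) = 1) :
    arityX.eval (aenv Φ.params n len [7, s, f1, f2, f3, f4, f5, f6]) ≤ Φ.FB n := by
  obtain ⟨hFB, h2X, h2R, h2NN, h2N1, hXeq, hTF, hTFB, hLreq⟩ := Φ.param_facts n
  obtain ⟨⟨h30, hs, hb1, hb2, hb3, hb4, hb5, hb6, hlen, hNpos⟩, hr⟩ := (wf_C Φ).1 h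
  rw [arity_C Φ h]
  split_ifs <;> omega

/-- Width bound for `BP` as a constant gate. [cite: KoiranPerifel2009VPSPACE, §3.2] -/
theorem wbound_BP (h : WF Φ n len [8, s, f1, f2, f3, f4, f5, f6]) (h1 : kindX.eval (aenv Φ.params n len [8, s, f1, f2, f3, f4, f5, f6]) ≠ 1)
    (_h2 : kindX.eval (aenv Φ.params n len [8, s, f1, f2, f3, f4, f5, f6]) ≠ 2) (_h3 : kindX.eval (aenv Φ.params n len [8, s, f1, f2, f3, f4, f5, f6]) ≠ 3) :
    widthX.eval (aenv Φ.params n len [8, s, f1, f2, f3, f4, f5, f6]) ≤ Φ.W₀ n + 1 := by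
  exfalso; rw [kind_BP Φ h] at h1; exact h1 rfl

/-- Arity bound for `BP` as a sum gate. [cite: KoiranPerifel2009VPSPACE, §3.2] -/
theorem abound_BP (h : WF Φ n len [8, s, f1, f2, f3, f4, f5, f6]) (_h1 : kindX.eval (aenv Φ.params n len [8, s, f1, f2, f3, f4, f5, f6]) = 1) :
    arityX.eval (aenv Φ.params n len [8, s, f1, f2, f3, f4, f5, f6]) ≤ Φ.FB n := by
  obtain ⟨hFB, h2X, h2R, h2NN, h2N1, hXeq, hTF, hTFB, hLreq⟩ := Φ.param_facts n
  obtain ⟨⟨h30, hs, hb1, hb2, hb3, hb4, hb5, hb6, hlen, hNpos⟩, hr⟩ := (wf_BP Φ).1 h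
  rw [arity_BP Φ h]
  split_ifs <;> omega

/-- Width bound for `SQ` as a constant gate. [cite: KoiranPerifel2009VPSPACE, §3.2] -/
theorem wbound_SQ (h : WF Φ n len [9, s, f1, f2, f3, f4, f5, f6]) (h1 : kindX.eval (aenv Φ.params n len [9, s, f1, f2, f3, f4, f5, f6]) ≠ 1)
    (_h2 : kindX.eval (aenv Φ.params n len [9, s, f1, f2, f3, f4, f5, f6]) ≠ 2) (_h3 : kindX.eval (aenv Φ.params n len [9, s, f1, f2, f3, f4, f5, f6]) ≠ 3) :
    widthX.eval (aenv Φ.params n len [9, s, f1, f2, f3, f4, f5, f6]) ≤ Φ.W₀ n + 1 := by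
  exfalso; rw [kind_SQ Φ h] at h1; exact h1 rfl

/-- Arity bound for `SQ` as a sum gate. [cite: KoiranPerifel2009VPSPACE, §3.2] -/
theorem abound_SQ (h : WF Φ n len [9, s, f1, f2, f3, f4, f5, f6]) (_h1 : kindX.eval (aenv Φ.params n len [9, s, f1, f2, f3, f4, f5, f6]) = 1) :
    arityX.eval (aenv Φ.params n len [9, s, f1, f2, f3, f4, f5, f6]) ≤ Φ.FB n := by
  obtain ⟨hFB, h2X, h2R, h2NN, h2N1, hXeq, hTF, hTFB, hLreq⟩ := Φ.param_facts n
  obtain ⟨⟨h30, hs, hb1, hb2, hb3, hb4, hb5, hb6, hlen, hNpos⟩, hr⟩ := (wf_SQ Φ).1 h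
  rw [arity_SQ Φ h]
  omega

/-- Width bound for `PSQ` as a constant gate. [cite: KoiranPerifel2009VPSPACE, §3.2] -/
theorem wbound_PSQ (h : WF Φ n len [10, s, f1, f2, f3, f4, f5, f6]) (_h1 : kindX.eval (aenv Φ.params n len [10, s, f1, f2, f3, f4, f5, f6]) ≠ 1)
    (h2 : kindX.eval (aenv Φ.params n len [10, s, f1, f2, f3, f4, f5, f6]) ≠ 2) (_h3 : kindX.eval (aenv Φ.params n len [10, s, f1, f2, f3, f4, f5, f6]) ≠ 3) :
    widthX.eval (aenv Φ.params n len [10, s, f1, f2, f3, f4, f5, f6]) ≤ Φ.W₀ n + 1 := by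
  exfalso; rw [kind_PSQ Φ h] at h2; exact h2 rfl

/-- Arity bound for `PSQ` as a sum gate. [cite: KoiranPerifel2009VPSPACE, §3.2] -/
theorem abound_PSQ (h : WF Φ n len [10, s, f1, f2, f3, f4, f5, f6]) (h1 : kindX.eval (aenv Φ.params n len [10, s, f1, f2, f3, f4, f5, f6]) = 1) :
    arityX.eval (aenv Φ.params n len [10, s, f1, f2, f3, f4, f5, f6]) ≤ Φ.FB n := by
  exfalso; rw [kind_PSQ Φ h] at h1; exact absurd h1 (by norm_num)

/-- Width bound for `PBP` as a constant gate. [cite: KoiranPerifel2009VPSPACE, §3.2] -/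
theorem wbound_PBP (h : WF Φ n len [11, s, f1, f2, f3, f4, f5, f6]) (_h1 : kindX.eval (aenv Φ.params n len [11, s, f1, f2, f3, f4, f5, f6]) ≠ 1)
    (h2 : kindX.eval (aenv Φ.params n len [11, s, f1, f2, f3, f4, f5, f6]) ≠ 2) (_h3 : kindX.eval (aenv Φ.params n len [11, s, f1, f2, f3, f4, f5, f6]) ≠ 3) :
    widthX.eval (aenv Φ.params n len [11, s, f1, f2, f3, f4, f5, f6]) ≤ Φ.W₀ n + 1 := by
  exfalso; rw [kind_PBP Φ h] at h2; exact h2 rfl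

/-- Arity bound for `PBP` as a sum gate. [cite: KoiranPerifel2009VPSPACE, §3.2] -/
theorem abound_PBP (h : WF Φ n len [11, s, f1, f2, f3, f4, f5, f6]) (h1 : kindX.eval (aenv Φ.params n len [11, s, f1, f2, f3, f4, f5, f6]) = 1) :
    arityX.eval (aenv Φ.params n len [11, s, f1, f2, f3, f4, f5, f6]) ≤ Φ.FB n := by
  exfalso; rw [kind_PBP Φ h] at h1; exact absurd h1 (by norm_num)

/-- Width bound for `CSQ` as a constant gate. [cite: KoiranPerifel2009VPSPACE, §3.2] -/
theorem wbound_CSQ (h : WF Φ n len [12, s, f1, f2, f3, f4, f5, f6]) (h1 : kindX.eval (aenv Φ.params n len [12, s, f1, f2, f3, f4, f5, f6]) ≠ 1)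
    (_h2 : kindX.eval (aenv Φ.params n len [12, s, f1, f2, f3, f4, f5, f6]) ≠ 2) (_h3 : kindX.eval (aenv Φ.params n len [12, s, f1, f2, f3, f4, f5, f6]) ≠ 3) :
    widthX.eval (aenv Φ.params n len [12, s, f1, f2, f3, f4, f5, f6]) ≤ Φ.W₀ n + 1 := by
  exfalso; rw [kind_CSQ Φ h] at h1; exact h1 rfl

/-- Arity bound for `CSQ` as a sum gate. [cite: KoiranPerifel2009VPSPACE, §3.2] -/
theorem abound_CSQ (h : WF Φ n len [12, s, f1, f2, f3, f4, f5, f6]) (_h1 : kindX.eval (aenv Φ.params n len [12, s, f1, f2, f3, f4, f5, f6]) = 1) :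
    arityX.eval (aenv Φ.params n len [12, s, f1, f2, f3, f4, f5, f6]) ≤ Φ.FB n := by
  obtain ⟨hFB, h2X, h2R, h2NN, h2N1, hXeq, hTF, hTFB, hLreq⟩ := Φ.param_facts n
  obtain ⟨⟨h30, hs, hb1, hb2, hb3, hb4, hb5, hb6, hlen, hNpos⟩, hr⟩ := (wf_CSQ Φ).1 h
  rw [arity_CSQ Φ h]
  omega

/-- Width bound for `PC` as a constant gate. [cite: KoiranPerifel2009VPSPACE, §3.2] -/
theorem wbound_PC (h : WF Φ n len [13, s, f1, f2, f3, f4, f5, f6]) (_h1 : kindX.eval (aenv Φ.params n len [13, s, f1, f2, f3, f4, f5, f6]) ≠ 1)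
    (h2 : kindX.eval (aenv Φ.params n len [13, s, f1, f2, f3, f4, f5, f6]) ≠ 2) (_h3 : kindX.eval (aenv Φ.params n len [13, s, f1, f2, f3, f4, f5, f6]) ≠ 3) :
    widthX.eval (aenv Φ.params n len [13, s, f1, f2, f3, f4, f5, f6]) ≤ Φ.W₀ n + 1 := by
  exfalso; rw [kind_PC Φ h] at h2; exact h2 rfl

/-- Arity bound for `PC` as a sum gate. [cite: KoiranPerifel2009VPSPACE, §3.2] -/
theorem abound_PC (h : WF Φ n len [13, s, f1, f2, f3, f4, f5, f6]) (h1 : kindX.eval (aenv Φ.params n len [13, s, f1, f2, f3, f4, f5, f6]) = 1) :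
    arityX.eval (aenv Φ.params n len [13, s, f1, f2, f3, f4, f5, f6]) ≤ Φ.FB n := by
  exfalso; rw [kind_PC Φ h] at h1; exact absurd h1 (by norm_num)

/-- Width bound for `QK` as a constant gate. [cite: KoiranPerifel2009VPSPACE, §3.2] -/
theorem wbound_QK (h : WF Φ n len [14, s, f1, f2, f3, f4, f5, f6]) (h1 : kindX.eval (aenv Φ.params n len [14, s, f1, f2, f3, f4, f5, f6]) ≠ 1)
    (_h2 : kindX.eval (aenv Φ.params n len [14, s, f1, f2, f3, f4, f5, f6]) ≠ 2) (_h3 : kindX.eval (aenv Φ.params n len [14, s, f1, f2, f3, f4, f5, f6]) ≠ 3) :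
    widthX.eval (aenv Φ.params n len [14, s, f1, f2, f3, f4, f5, f6]) ≤ Φ.W₀ n + 1 := by
  exfalso; rw [kind_QK Φ h] at h1; exact h1 rfl

/-- Arity bound for `QK` as a sum gate. [cite: KoiranPerifel2009VPSPACE, §3.2] -/
theorem abound_QK (h : WF Φ n len [14, s, f1, f2, f3, f4, f5, f6]) (_h1 : kindX.eval (aenv Φ.params n len [14, s, f1, f2, f3, f4, f5, f6]) = 1) :
    arityX.eval (aenv Φ.params n len [14, s, f1, f2, f3, f4, f5, f6]) ≤ Φ.FB n := by
  obtain ⟨hFB, h2X, h2R, h2NN, h2N1, hXeq, hTF, hTFB, hLreq⟩ := Φ.param_facts n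
  obtain ⟨⟨h30, hs, hb1, hb2, hb3, hb4, hb5, hb6, hlen, hNpos⟩, hr⟩ := (wf_QK Φ).1 h
  rw [arity_QK Φ h]
  omega

/-- Width bound for `PQK` as a constant gate. [cite: KoiranPerifel2009VPSPACE, §3.2] -/
theorem wbound_PQK (h : WF Φ n len [15, s, f1, f2, f3, f4, f5, f6]) (_h1 : kindX.eval (aenv Φ.params n len [15, s, f1, f2, f3, f4, f5, f6]) ≠ 1)
    (h2 : kindX.eval (aenv Φ.params n len [15, s, f1, f2, f3, f4, f5, f6]) ≠ 2) (_h3 : kindX.eval (aenv Φ.params n len [15, s, f1, f2, f3, f4, f5, f6]) ≠ 3) :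
    widthX.eval (aenv Φ.params n len [15, s, f1, f2, f3, f4, f5, f6]) ≤ Φ.W₀ n + 1 := by
  exfalso; rw [kind_PQK Φ h] at h2; exact h2 rfl

/-- Arity bound for `PQK` as a sum gate. [cite: KoiranPerifel2009VPSPACE, §3.2] -/
theorem abound_PQK (h : WF Φ n len [15, s, f1, f2, f3, f4, f5, f6]) (h1 : kindX.eval (aenv Φ.params n len [15, s, f1, f2, f3, f4, f5, f6]) = 1) :
    arityX.eval (aenv Φ.params n len [15, s, f1, f2, f3, f4, f5, f6]) ≤ Φ.FB n := by
  exfalso; rw [kind_PQK Φ h] at h1; exact absurd h1 (by norm_num)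

/-- Width bound for `QT` as a constant gate. [cite: KoiranPerifel2009VPSPACE, §3.2] -/
theorem wbound_QT (h : WF Φ n len [16, s, f1, f2, f3, f4, f5, f6]) (_h1 : kindX.eval (aenv Φ.params n len [16, s, f1, f2, f3, f4, f5, f6]) ≠ 1)
    (_h2 : kindX.eval (aenv Φ.params n len [16, s, f1, f2, f3, f4, f5, f6]) ≠ 2) (h3 : kindX.eval (aenv Φ.params n len [16, s, f1, f2, f3, f4, f5, f6]) ≠ 3) :
    widthX.eval (aenv Φ.params n len [16, s, f1, f2, f3, f4, f5, f6]) ≤ Φ.W₀ n + 1 := by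
  exfalso; rw [kind_QT Φ h] at h3; exact h3 rfl

/-- Arity bound for `QT` as a sum gate. [cite: KoiranPerifel2009VPSPACE, §3.2] -/
theorem abound_QT (h : WF Φ n len [16, s, f1, f2, f3, f4, f5, f6]) (h1 : kindX.eval (aenv Φ.params n len [16, s, f1, f2, f3, f4, f5, f6]) = 1) :
    arityX.eval (aenv Φ.params n len [16, s, f1, f2, f3, f4, f5, f6]) ≤ Φ.FB n := by
  exfalso; rw [kind_QT Φ h] at h1; exact absurd h1 (by norm_num)

/-- Width bound for `QT2` as a constant gate. [cite: KoiranPerifel2009VPSPACE, §3.2] -/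
theorem wbound_QT2 (h : WF Φ n len [17, s, f1, f2, f3, f4, f5, f6]) (_h1 : kindX.eval (aenv Φ.params n len [17, s, f1, f2, f3, f4, f5, f6]) ≠ 1)
    (_h2 : kindX.eval (aenv Φ.params n len [17, s, f1, f2, f3, f4, f5, f6]) ≠ 2) (h3 : kindX.eval (aenv Φ.params n len [17, s, f1, f2, f3, f4, f5, f6]) ≠ 3) :
    widthX.eval (aenv Φ.params n len [17, s, f1, f2, f3, f4, f5, f6]) ≤ Φ.W₀ n + 1 := by
  exfalso; rw [kind_QT2 Φ h] at h3; exact h3 rfl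

/-- Arity bound for `QT2` as a sum gate. [cite: KoiranPerifel2009VPSPACE, §3.2] -/
theorem abound_QT2 (h : WF Φ n len [17, s, f1, f2, f3, f4, f5, f6]) (h1 : kindX.eval (aenv Φ.params n len [17, s, f1, f2, f3, f4, f5, f6]) = 1) :
    arityX.eval (aenv Φ.params n len [17, s, f1, f2, f3, f4, f5, f6]) ≤ Φ.FB n := by
  exfalso; rw [kind_QT2 Φ h] at h1; exact absurd h1 (by norm_num)

/-- Width bound for `QB` as a constant gate. [cite: KoiranPerifel2009VPSPACE, §3.2] -/
theorem wbound_QB (h : WF Φ n len [18, s, f1, f2, f3, f4, f5, f6]) (h1 : kindX.eval (aenv Φ.params n len [18, s, f1, f2, f3, f4, f5, f6]) ≠ 1)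
    (_h2 : kindX.eval (aenv Φ.params n len [18, s, f1, f2, f3, f4, f5, f6]) ≠ 2) (_h3 : kindX.eval (aenv Φ.params n len [18, s, f1, f2, f3, f4, f5, f6]) ≠ 3) :
    widthX.eval (aenv Φ.params n len [18, s, f1, f2, f3, f4, f5, f6]) ≤ Φ.W₀ n + 1 := by
  exfalso; rw [kind_QB Φ h] at h1; exact h1 rfl

/-- Arity bound for `QB` as a sum gate. [cite: KoiranPerifel2009VPSPACE, §3.2] -/
theorem abound_QB (h : WF Φ n len [18, s, f1, f2, f3, f4, f5, f6]) (_h1 : kindX.eval (aenv Φ.params n len [18, s, f1, f2, f3, f4, f5, f6]) = 1) :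
    arityX.eval (aenv Φ.params n len [18, s, f1, f2, f3, f4, f5, f6]) ≤ Φ.FB n := by
  obtain ⟨hFB, h2X, h2R, h2NN, h2N1, hXeq, hTF, hTFB, hLreq⟩ := Φ.param_facts n
  obtain ⟨⟨h30, hs, hb1, hb2, hb3, hb4, hb5, hb6, hlen, hNpos⟩, hr⟩ := (wf_QB Φ).1 h
  rw [arity_QB Φ h]
  omega

/-- Width bound for `QSQ` as a constant gate. [cite: KoiranPerifel2009VPSPACE, §3.2] -/
theorem wbound_QSQ (h : WF Φ n len [19, s, f1, f2, f3, f4, f5, f6]) (h1 : kindX.eval (aenv Φ.params n len [19, s, f1, f2, f3, f4, f5, f6]) ≠ 1)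
    (_h2 : kindX.eval (aenv Φ.params n len [19, s, f1, f2, f3, f4, f5, f6]) ≠ 2) (_h3 : kindX.eval (aenv Φ.params n len [19, s, f1, f2, f3, f4, f5, f6]) ≠ 3) :
    widthX.eval (aenv Φ.params n len [19, s, f1, f2, f3, f4, f5, f6]) ≤ Φ.W₀ n + 1 := by
  exfalso; rw [kind_QSQ Φ h] at h1; exact h1 rfl

/-- Arity bound for `QSQ` as a sum gate. [cite: KoiranPerifel2009VPSPACE, §3.2] -/
theorem abound_QSQ (h : WF Φ n len [19, s, f1, f2, f3, f4, f5, f6]) (_h1 : kindX.eval (aenv Φ.params n len [19, s, f1, f2, f3, f4, f5, f6]) = 1) :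
    arityX.eval (aenv Φ.params n len [19, s, f1, f2, f3, f4, f5, f6]) ≤ Φ.FB n := by
  obtain ⟨hFB, h2X, h2R, h2NN, h2N1, hXeq, hTF, hTFB, hLreq⟩ := Φ.param_facts n
  obtain ⟨⟨h30, hs, hb1, hb2, hb3, hb4, hb5, hb6, hlen, hNpos⟩, hr⟩ := (wf_QSQ Φ).1 h
  rw [arity_QSQ Φ h]
  omega

/-- Width bound for `PQ` as a constant gate. [cite: KoiranPerifel2009VPSPACE, §3.2] -/
theorem wbound_PQ (h : WF Φ n len [20, s, f1, f2, f3, f4, f5, f6]) (_h1 : kindX.eval (aenv Φ.params n len [20, s, f1, f2, f3, f4, f5, f6]) ≠ 1)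
    (h2 : kindX.eval (aenv Φ.params n len [20, s, f1, f2, f3, f4, f5, f6]) ≠ 2) (_h3 : kindX.eval (aenv Φ.params n len [20, s, f1, f2, f3, f4, f5, f6]) ≠ 3) :
    widthX.eval (aenv Φ.params n len [20, s, f1, f2, f3, f4, f5, f6]) ≤ Φ.W₀ n + 1 := by
  exfalso; rw [kind_PQ Φ h] at h2; exact h2 rfl

/-- Arity bound for `PQ` as a sum gate. [cite: KoiranPerifel2009VPSPACE, §3.2] -/
theorem abound_PQ (h : WF Φ n len [20, s, f1, f2, f3, f4, f5, f6]) (h1 : kindX.eval (aenv Φ.params n len [20, s, f1, f2, f3, f4, f5, f6]) = 1) :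
    arityX.eval (aenv Φ.params n len [20, s, f1, f2, f3, f4, f5, f6]) ≤ Φ.FB n := by
  exfalso; rw [kind_PQ Φ h] at h1; exact absurd h1 (by norm_num)

/-- Width bound for `NT` as a constant gate. [cite: KoiranPerifel2009VPSPACE, §3.2] -/
theorem wbound_NT (h : WF Φ n len [21, s, f1, f2, f3, f4, f5, f6]) (_h1 : kindX.eval (aenv Φ.params n len [21, s, f1, f2, f3, f4, f5, f6]) ≠ 1)
    (_h2 : kindX.eval (aenv Φ.params n len [21, s, f1, f2, f3, f4, f5, f6]) ≠ 2) (h3 : kindX.eval (aenv Φ.params n len [21, s, f1, f2, f3, f4, f5, f6]) ≠ 3) :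
    widthX.eval (aenv Φ.params n len [21, s, f1, f2, f3, f4, f5, f6]) ≤ Φ.W₀ n + 1 := by
  exfalso; rw [kind_NT Φ h] at h3; exact h3 rfl

/-- Arity bound for `NT` as a sum gate. [cite: KoiranPerifel2009VPSPACE, §3.2] -/
theorem abound_NT (h : WF Φ n len [21, s, f1, f2, f3, f4, f5, f6]) (h1 : kindX.eval (aenv Φ.params n len [21, s, f1, f2, f3, f4, f5, f6]) = 1) :
    arityX.eval (aenv Φ.params n len [21, s, f1, f2, f3, f4, f5, f6]) ≤ Φ.FB n := by
  exfalso; rw [kind_NT Φ h] at h1; exact absurd h1 (by norm_num)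

/-- Width bound for `NT2` as a constant gate. [cite: KoiranPerifel2009VPSPACE, §3.2] -/
theorem wbound_NT2 (h : WF Φ n len [22, s, f1, f2, f3, f4, f5, f6]) (_h1 : kindX.eval (aenv Φ.params n len [22, s, f1, f2, f3, f4, f5, f6]) ≠ 1)
    (_h2 : kindX.eval (aenv Φ.params n len [22, s, f1, f2, f3, f4, f5, f6]) ≠ 2) (h3 : kindX.eval (aenv Φ.params n len [22, s, f1, f2, f3, f4, f5, f6]) ≠ 3) :
    widthX.eval (aenv Φ.params n len [22, s, f1, f2, f3, f4, f5, f6]) ≤ Φ.W₀ n + 1 := by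
  exfalso; rw [kind_NT2 Φ h] at h3; exact h3 rfl

/-- Arity bound for `NT2` as a sum gate. [cite: KoiranPerifel2009VPSPACE, §3.2] -/
theorem abound_NT2 (h : WF Φ n len [22, s, f1, f2, f3, f4, f5, f6]) (h1 : kindX.eval (aenv Φ.params n len [22, s, f1, f2, f3, f4, f5, f6]) = 1) :
    arityX.eval (aenv Φ.params n len [22, s, f1, f2, f3, f4, f5, f6]) ≤ Φ.FB n := by
  exfalso; rw [kind_NT2 Φ h] at h1; exact absurd h1 (by norm_num)

/-- Width bound for `NB` as a constant gate. [cite: KoiranPerifel2009VPSPACE, §3.2] -/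
theorem wbound_NB (h : WF Φ n len [23, s, f1, f2, f3, f4, f5, f6]) (h1 : kindX.eval (aenv Φ.params n len [23, s, f1, f2, f3, f4, f5, f6]) ≠ 1)
    (_h2 : kindX.eval (aenv Φ.params n len [23, s, f1, f2, f3, f4, f5, f6]) ≠ 2) (_h3 : kindX.eval (aenv Φ.params n len [23, s, f1, f2, f3, f4, f5, f6]) ≠ 3) :
    widthX.eval (aenv Φ.params n len [23, s, f1, f2, f3, f4, f5, f6]) ≤ Φ.W₀ n + 1 := by
  exfalso; rw [kind_NB Φ h] at h1; exact h1 rfl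

/-- Arity bound for `NB` as a sum gate. [cite: KoiranPerifel2009VPSPACE, §3.2] -/
theorem abound_NB (h : WF Φ n len [23, s, f1, f2, f3, f4, f5, f6]) (_h1 : kindX.eval (aenv Φ.params n len [23, s, f1, f2, f3, f4, f5, f6]) = 1) :
    arityX.eval (aenv Φ.params n len [23, s, f1, f2, f3, f4, f5, f6]) ≤ Φ.FB n := by
  obtain ⟨hFB, h2X, h2R, h2NN, h2N1, hXeq, hTF, hTFB, hLreq⟩ := Φ.param_facts n
  obtain ⟨⟨h30, hs, hb1, hb2, hb3, hb4, hb5, hb6, hlen, hNpos⟩, hr⟩ := (wf_NB Φ).1 h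
  rw [arity_NB Φ h]
  omega

/-- Width bound for `COLSQ` as a constant gate. [cite: KoiranPerifel2009VPSPACE, §3.2] -/
theorem wbound_COLSQ (h : WF Φ n len [24, s, f1, f2, f3, f4, f5, f6]) (h1 : kindX.eval (aenv Φ.params n len [24, s, f1, f2, f3, f4, f5, f6]) ≠ 1)
    (_h2 : kindX.eval (aenv Φ.params n len [24, s, f1, f2, f3, f4, f5, f6]) ≠ 2) (_h3 : kindX.eval (aenv Φ.params n len [24, s, f1, f2, f3, f4, f5, f6]) ≠ 3) :
    widthX.eval (aenv Φ.params n len [24, s, f1, f2, f3, f4, f5, f6]) ≤ Φ.W₀ n + 1 := by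
  exfalso; rw [kind_COLSQ Φ h] at h1; exact h1 rfl

/-- Arity bound for `COLSQ` as a sum gate. [cite: KoiranPerifel2009VPSPACE, §3.2] -/
theorem abound_COLSQ (h : WF Φ n len [24, s, f1, f2, f3, f4, f5, f6]) (_h1 : kindX.eval (aenv Φ.params n len [24, s, f1, f2, f3, f4, f5, f6]) = 1) :
    arityX.eval (aenv Φ.params n len [24, s, f1, f2, f3, f4, f5, f6]) ≤ Φ.FB n := by
  obtain ⟨hFB, h2X, h2R, h2NN, h2N1, hXeq, hTF, hTFB, hLreq⟩ := Φ.param_facts n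
  obtain ⟨⟨h30, hs, hb1, hb2, hb3, hb4, hb5, hb6, hlen, hNpos⟩, hr⟩ := (wf_COLSQ Φ).1 h
  rw [arity_COLSQ Φ h]
  omega

/-- Width bound for `PN` as a constant gate. [cite: KoiranPerifel2009VPSPACE, §3.2] -/
theorem wbound_PN (h : WF Φ n len [25, s, f1, f2, f3, f4, f5, f6]) (_h1 : kindX.eval (aenv Φ.params n len [25, s, f1, f2, f3, f4, f5, f6]) ≠ 1)
    (h2 : kindX.eval (aenv Φ.params n len [25, s, f1, f2, f3, f4, f5, f6]) ≠ 2) (_h3 : kindX.eval (aenv Φ.params n len [25, s, f1, f2, f3, f4, f5, f6]) ≠ 3) :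
    widthX.eval (aenv Φ.params n len [25, s, f1, f2, f3, f4, f5, f6]) ≤ Φ.W₀ n + 1 := by
  exfalso; rw [kind_PN Φ h] at h2; exact h2 rfl

/-- Arity bound for `PN` as a sum gate. [cite: KoiranPerifel2009VPSPACE, §3.2] -/
theorem abound_PN (h : WF Φ n len [25, s, f1, f2, f3, f4, f5, f6]) (h1 : kindX.eval (aenv Φ.params n len [25, s, f1, f2, f3, f4, f5, f6]) = 1) :
    arityX.eval (aenv Φ.params n len [25, s, f1, f2, f3, f4, f5, f6]) ≤ Φ.FB n := by
  exfalso; rw [kind_PN Φ h] at h1; exact absurd h1 (by norm_num)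

/-- Width bound for `PRE` as a constant gate. [cite: KoiranPerifel2009VPSPACE, §3.2] -/
theorem wbound_PRE (h : WF Φ n len [26, s, f1, f2, f3, f4, f5, f6]) (h1 : kindX.eval (aenv Φ.params n len [26, s, f1, f2, f3, f4, f5, f6]) ≠ 1)
    (_h2 : kindX.eval (aenv Φ.params n len [26, s, f1, f2, f3, f4, f5, f6]) ≠ 2) (_h3 : kindX.eval (aenv Φ.params n len [26, s, f1, f2, f3, f4, f5, f6]) ≠ 3) :
    widthX.eval (aenv Φ.params n len [26, s, f1, f2, f3, f4, f5, f6]) ≤ Φ.W₀ n + 1 := by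
  exfalso; rw [kind_PRE Φ h] at h1; exact h1 rfl

/-- Arity bound for `PRE` as a sum gate. [cite: KoiranPerifel2009VPSPACE, §3.2] -/
theorem abound_PRE (h : WF Φ n len [26, s, f1, f2, f3, f4, f5, f6]) (_h1 : kindX.eval (aenv Φ.params n len [26, s, f1, f2, f3, f4, f5, f6]) = 1) :
    arityX.eval (aenv Φ.params n len [26, s, f1, f2, f3, f4, f5, f6]) ≤ Φ.FB n := by
  obtain ⟨hFB, h2X, h2R, h2NN, h2N1, hXeq, hTF, hTFB, hLreq⟩ := Φ.param_facts n
  obtain ⟨⟨h30, hs, hb1, hb2, hb3, hb4, hb5, hb6, hlen, hNpos⟩, hr⟩ := (wf_PRE Φ).1 h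
  rw [arity_PRE Φ h]
  omega

/-- Width bound for `VT` as a constant gate. [cite: KoiranPerifel2009VPSPACE, §3.2] -/
theorem wbound_VT (h : WF Φ n len [27, s, f1, f2, f3, f4, f5, f6]) (_h1 : kindX.eval (aenv Φ.params n len [27, s, f1, f2, f3, f4, f5, f6]) ≠ 1)
    (_h2 : kindX.eval (aenv Φ.params n len [27, s, f1, f2, f3, f4, f5, f6]) ≠ 2) (h3 : kindX.eval (aenv Φ.params n len [27, s, f1, f2, f3, f4, f5, f6]) ≠ 3) :
    widthX.eval (aenv Φ.params n len [27, s, f1, f2, f3, f4, f5, f6]) ≤ Φ.W₀ n + 1 := by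
  exfalso; rw [kind_VT Φ h] at h3; exact h3 rfl

/-- Arity bound for `VT` as a sum gate. [cite: KoiranPerifel2009VPSPACE, §3.2] -/
theorem abound_VT (h : WF Φ n len [27, s, f1, f2, f3, f4, f5, f6]) (h1 : kindX.eval (aenv Φ.params n len [27, s, f1, f2, f3, f4, f5, f6]) = 1) :
    arityX.eval (aenv Φ.params n len [27, s, f1, f2, f3, f4, f5, f6]) ≤ Φ.FB n := by
  exfalso; rw [kind_VT Φ h] at h1; exact absurd h1 (by norm_num)

/-- Width bound for `VT2` as a constant gate. [cite: KoiranPerifel2009VPSPACE, §3.2] -/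
theorem wbound_VT2 (h : WF Φ n len [28, s, f1, f2, f3, f4, f5, f6]) (_h1 : kindX.eval (aenv Φ.params n len [28, s, f1, f2, f3, f4, f5, f6]) ≠ 1)
    (_h2 : kindX.eval (aenv Φ.params n len [28, s, f1, f2, f3, f4, f5, f6]) ≠ 2) (h3 : kindX.eval (aenv Φ.params n len [28, s, f1, f2, f3, f4, f5, f6]) ≠ 3) :
    widthX.eval (aenv Φ.params n len [28, s, f1, f2, f3, f4, f5, f6]) ≤ Φ.W₀ n + 1 := by
  exfalso; rw [kind_VT2 Φ h] at h3; exact h3 rfl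

/-- Arity bound for `VT2` as a sum gate. [cite: KoiranPerifel2009VPSPACE, §3.2] -/
theorem abound_VT2 (h : WF Φ n len [28, s, f1, f2, f3, f4, f5, f6]) (h1 : kindX.eval (aenv Φ.params n len [28, s, f1, f2, f3, f4, f5, f6]) = 1) :
    arityX.eval (aenv Φ.params n len [28, s, f1, f2, f3, f4, f5, f6]) ≤ Φ.FB n := by
  exfalso; rw [kind_VT2 Φ h] at h1; exact absurd h1 (by norm_num)

/-- Width bound for `V` as a constant gate. [cite: KoiranPerifel2009VPSPACE, §3.2] -/
theorem wbound_V (h : WF Φ n len [29, s, f1, f2, f3, f4, f5, f6]) (h1 : kindX.eval (aenv Φ.params n len [29, s, f1, f2, f3, f4, f5, f6]) ≠ 1)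
    (_h2 : kindX.eval (aenv Φ.params n len [29, s, f1, f2, f3, f4, f5, f6]) ≠ 2) (_h3 : kindX.eval (aenv Φ.params n len [29, s, f1, f2, f3, f4, f5, f6]) ≠ 3) :
    widthX.eval (aenv Φ.params n len [29, s, f1, f2, f3, f4, f5, f6]) ≤ Φ.W₀ n + 1 := by
  exfalso; rw [kind_V Φ h] at h1; exact h1 rfl

/-- Arity bound for `V` as a sum gate. [cite: KoiranPerifel2009VPSPACE, §3.2] -/
theorem abound_V (h : WF Φ n len [29, s, f1, f2, f3, f4, f5, f6]) (_h1 : kindX.eval (aenv Φ.params n len [29, s, f1, f2, f3, f4, f5, f6]) = 1) :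
    arityX.eval (aenv Φ.params n len [29, s, f1, f2, f3, f4, f5, f6]) ≤ Φ.FB n := by
  obtain ⟨hFB, h2X, h2R, h2NN, h2N1, hXeq, hTF, hTFB, hLreq⟩ := Φ.param_facts n
  obtain ⟨⟨h30, hs, hb1, hb2, hb3, hb4, hb5, hb6, hlen, hNpos⟩, hr⟩ := (wf_V Φ).1 h
  rw [arity_V Φ h]
  omega

/-- Width bound for `ZERO` as a constant gate. [cite: KoiranPerifel2009VPSPACE, §3.2] -/
theorem wbound_ZERO (h : WF Φ n len [30, s, f1, f2, f3, f4, f5, f6]) (_h1 : kindX.eval (aenv Φ.params n len [30, s, f1, f2, f3, f4, f5, f6]) ≠ 1)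
    (_h2 : kindX.eval (aenv Φ.params n len [30, s, f1, f2, f3, f4, f5, f6]) ≠ 2) (_h3 : kindX.eval (aenv Φ.params n len [30, s, f1, f2, f3, f4, f5, f6]) ≠ 3) :
    widthX.eval (aenv Φ.params n len [30, s, f1, f2, f3, f4, f5, f6]) ≤ Φ.W₀ n + 1 := by
  rw [width_ZERO Φ h]; omega

/-- Arity bound for `ZERO` as a sum gate. [cite: KoiranPerifel2009VPSPACE, §3.2] -/
theorem abound_ZERO (h : WF Φ n len [30, s, f1, f2, f3, f4, f5, f6]) (h1 : kindX.eval (aenv Φ.params n len [30, s, f1, f2, f3, f4, f5, f6]) = 1) :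
    arityX.eval (aenv Φ.params n len [30, s, f1, f2, f3, f4, f5, f6]) ≤ Φ.FB n := by
  exfalso; rw [kind_ZERO Φ h] at h1; exact absurd h1 (by norm_num)

/-- **Constant gates of well-formed tuples have width `≤ W₀ + 1`.** [cite: KoiranPerifel2009VPSPACE, §3.2] -/
theorem wbound_all {t : List ℕ} (ht : t.length = 8) (h : WF Φ n len t) (h1 : kindX.eval (aenv Φ.params n len t) ≠ 1)
    (h2 : kindX.eval (aenv Φ.params n len t) ≠ 2) (h3 : kindX.eval (aenv Φ.params n len t) ≠ 3) :
    widthX.eval (aenv Φ.params n len t) ≤ Φ.W₀ n + 1 := by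
  obtain ⟨a0, s, f1, f2, f3, f4, f5, f6, rfl⟩ := exists_eq_eight ht
  have ha : a0 ≤ 30 := h.1.1
  interval_cases a0
  · exact wbound_ONE Φ h h1 h2 h3
  · exact wbound_A Φ h h1 h2 h3
  · exact wbound_B Φ h h1 h2 h3
  · exact wbound_PA Φ h h1 h2 h3
  · exact wbound_M Φ h h1 h2 h3
  · exact wbound_P Φ h h1 h2 h3
  · exact wbound_PP Φ h h1 h2 h3
  · exact wbound_C Φ h h1 h2 h3
  · exact wbound_BP Φ h h1 h2 h3
  · exact wbound_SQ Φ h h1 h2 h3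
  · exact wbound_PSQ Φ h h1 h2 h3
  · exact wbound_PBP Φ h h1 h2 h3
  · exact wbound_CSQ Φ h h1 h2 h3
  · exact wbound_PC Φ h h1 h2 h3
  · exact wbound_QK Φ h h1 h2 h3
  · exact wbound_PQK Φ h h1 h2 h3
  · exact wbound_QT Φ h h1 h2 h3
  · exact wbound_QT2 Φ h h1 h2 h3
  · exact wbound_QB Φ h h1 h2 h3
  · exact wbound_QSQ Φ h h1 h2 h3
  · exact wbound_PQ Φ h h1 h2 h3
  · exact wbound_NT Φ h h1 h2 h3
  · exact wbound_NT2 Φ h h1 h2 h3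
  · exact wbound_NB Φ h h1 h2 h3
  · exact wbound_COLSQ Φ h h1 h2 h3
  · exact wbound_PN Φ h h1 h2 h3
  · exact wbound_PRE Φ h h1 h2 h3
  · exact wbound_VT Φ h h1 h2 h3
  · exact wbound_VT2 Φ h h1 h2 h3
  · exact wbound_V Φ h h1 h2 h3
  · exact wbound_ZERO Φ h h1 h2 h3

/-- **Sum gates of well-formed tuples have arity `≤ 2^{Fb}`.** [cite: KoiranPerifel2009VPSPACE, §3.2] -/
theorem abound_all {t : List ℕ} (ht : t.length = 8) (h : WF Φ n len t) (h1 : kindX.eval (aenv Φ.params n len t) = 1) :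
    arityX.eval (aenv Φ.params n len t) ≤ Φ.FB n := by
  obtain ⟨a0, s, f1, f2, f3, f4, f5, f6, rfl⟩ := exists_eq_eight ht
  have ha : a0 ≤ 30 := h.1.1
  interval_cases a0
  · exact abound_ONE Φ h h1
  · exact abound_A Φ h h1
  · exact abound_B Φ h h1
  · exact abound_PA Φ h h1
  · exact abound_M Φ h h1
  · exact abound_P Φ h h1
  · exact abound_PP Φ h h1
  · exact abound_C Φ h h1
  · exact abound_BP Φ h h1
  · exact abound_SQ Φ h h1
  · exact abound_PSQ Φ h h1
  · exact abound_PBP Φ h h1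
  · exact abound_CSQ Φ h h1
  · exact abound_PC Φ h h1
  · exact abound_QK Φ h h1
  · exact abound_PQK Φ h h1
  · exact abound_QT Φ h h1
  · exact abound_QT2 Φ h h1
  · exact abound_QB Φ h h1
  · exact abound_QSQ Φ h h1
  · exact abound_PQ Φ h h1
  · exact abound_NT Φ h h1
  · exact abound_NT2 Φ h h1
  · exact abound_NB Φ h h1
  · exact abound_COLSQ Φ h h1
  · exact abound_PN Φ h h1
  · exact abound_PRE Φ h h1
  · exact abound_VT Φ h h1
  · exact abound_VT2 Φ h h1
  · exact abound_V Φ h h1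
  · exact abound_ZERO Φ h h1

end SyntaxTags

/-! ### The circuit -/

section Circuit

/-- The positive (`s = 0`) or negative (`s ≠ 0`) part of an integer, as a natural number. [folklore] -/
def ipart (s : ℕ) (z : ℤ) : ℕ := if s = 0 then z.toNat else (-z).toNat

/-- The constant bits, read off decoded data `((wf flag, tag, sign field, entry), bit index)`. [folklore] -/
def cbitL (q : (ℕ × ℕ × ℕ × ℤ) × ℕ) : Bool :=
  if q.1.1 = 0 then false
  else if q.1.2.1 = 0 then decide (q.2 = 0)
  else if q.1.2.1 = 1 then (ipart q.1.2.2.1 q.1.2.2.2).testBit q.2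
  else false

/-- The decoded data a constant gate needs: the well-formedness flag, the tag, the sign field, the
entry `A n f1 f2`. [folklore] -/
def cbitArgs (g : List Bool) : ℕ × ℕ × ℕ × ℤ :=
  (geval Φ.params 8 wf g, (gfields 8 (sndF g)).getD 0 0, (gfields 8 (sndF g)).getD 1 0,
    Φ.A (gidx g) ((gfields 8 (sndF g)).getD 2 0) ((gfields 8 (sndF g)).getD 3 0))

/-- **The constant bits of the circuit**: an `A(s,r,c)` gate carries the `s`-part of `A n r c`,
the gate `ONE` carries `1`, everything else `0`. [cite: KoiranPerifel2009VPSPACE, §3.2, Prop. 1 (input gates)] -/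
def cbitF (g : List Bool) (i : ℕ) : Bool := cbitL (cbitArgs Φ g, i)

/-- `codeFP_ipart` (plumbing). [folklore] -/
private theorem codeFP_ipart : CodeFP (pairE natE intE) natE (fun p => ipart p.1 p.2) :=
  (CodeFP.ite (natEq.comp ((fst natE intE).pair (const _ 0))) (intToNat.comp (snd natE intE))
    (intToNat.comp (intNeg.comp (snd natE intE)))).congr fun p => by
      unfold ipart; simp only [decide_eq_true_eq]

set_option maxHeartbeats 800000 in
/-- `cbitL` is polynomial time. [folklore] -/
private theorem codeFP_cbitL : CodeFP (pairE (pairE natE (pairE natE (pairE natE intE))) natE) bitE cbitL := by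
  have q1 : CodeFP (pairE (pairE natE (pairE natE (pairE natE intE))) natE) natE (fun q => q.1.1) :=
    (fst _ _).fst'
  have q2 : CodeFP (pairE (pairE natE (pairE natE (pairE natE intE))) natE) natE (fun q => q.1.2.1) :=
    (fst _ _).snd'.fst'
  have q3 : CodeFP (pairE (pairE natE (pairE natE (pairE natE intE))) natE) natE (fun q => q.1.2.2.1) :=
    (fst _ _).snd'.snd'.fst'
  have q4 : CodeFP (pairE (pairE natE (pairE natE (pairE natE intE))) natE) intE (fun q => q.1.2.2.2) :=
    (fst _ _).snd'.snd'.snd'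
  have q5 : CodeFP (pairE (pairE natE (pairE natE (pairE natE intE))) natE) natE (fun q => q.2) := snd _ _
  exact (CodeFP.ite (natEq.comp (q1.pair (const _ 0))) (const _ false)
    (CodeFP.ite (natEq.comp (q2.pair (const _ 0))) (natEq.comp (q5.pair (const _ 0)))
    (CodeFP.ite (natEq.comp (q2.pair (const _ 1))) (testBitNat.comp ((codeFP_ipart.comp (q3.pair q4)).pair q5))
    (const _ false)))).congr fun q => by unfold cbitL; simp only [decide_eq_true_eq]

set_option maxHeartbeats 800000 in
/-- The decoded data of a constant gate is polynomial time. [cite: AroraBarak2009, §1.3] -/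
theorem codeFP_cbitArgs : CodeFP strE (pairE natE (pairE natE (pairE natE intE))) (cbitArgs Φ) := by
  have hf : CodeFP strE (rawE natE) (fun g => gfields 8 (sndF g)) :=
    (codeFP_gfields 8).comp (of_fn (eα := strE) (eβ := strE) (g := sndF) sndF sndF_mem_FP fun _ => rfl)
  have fld : ∀ j : ℕ, CodeFP strE natE (fun g => (gfields 8 (sndF g)).getD j 0) := fun j =>
    ((rawGetD natE (d := 0) rfl).comp (hf.pair (const _ j))).congr fun _ => rfl
  have hw : CodeFP strE natE (geval Φ.params 8 wf) := codeFP_geval Φ.params_fp 8 wf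
  have hA : CodeFP strE intE (fun g => Φ.A (gidx g) ((gfields 8 (sndF g)).getD 2 0) ((gfields 8 (sndF g)).getD 3 0)) :=
    (Φ.A_fp.comp (codeFP_gidx.pair ((fld 2).pair (fld 3)))).congr fun _ => rfl
  exact (hw.pair ((fld 0).pair ((fld 1).pair hA))).congr fun _ => rfl

/-- **The constant bits are polynomial time** on `⟨name, bit index⟩`. [cite: AroraBarak2009, §1.3] -/
theorem codeFP_cbitF : CodeFP (pairE strE natE) bitE (fun p => cbitF Φ p.1 p.2) :=
  (codeFP_cbitL.comp (((codeFP_cbitArgs Φ).comp (fst strE natE)).pair (snd strE natE))).congr fun _ => rfl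

/-- The depth axiom, for every string. [cite: KoiranPerifel2009VPSPACE, §3.2] -/
theorem kvc_depth_child (g : List Bool) (k : ℕ)
    (hk : k < gateFanIn (geval Φ.params 8 kindX g) (geval Φ.params 8 arityX g)) :
    geval Φ.params 8 depthX (gchild Φ.params 8 childX g k) < geval Φ.params 8 depthX g := by
  have ht : (gfields 8 (sndF g)).length = 8 := length_gfields 8 _
  unfold geval at hk ⊢
  rw [genv_eq] at hk
  have hpos : 0 < kindX.eval (aenv Φ.params (gidx g) g.length (gfields 8 (sndF g))) := by
    by_contra h0
    rw [Nat.eq_zero_of_not_pos h0] at hk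
    simp [gateFanIn] at hk
  have hwf := wf_of_kind_pos Φ ht hpos
  obtain ⟨hfit, -, hlt⟩ := step_all Φ ht hwf k hk
  rw [gchild_eq, genv_gname' Φ.params (by simp [childX]) hfit, genv_eq]
  exact hlt

/-- The depth bound, for every string. [cite: KoiranPerifel2009VPSPACE, §3.2] -/
theorem kvc_depth_le (g : List Bool) :
    geval Φ.params 8 depthX g ≤ (Polynomial.X + Polynomial.C 22 : Polynomial ℕ).eval g.length := by
  have ht : (gfields 8 (sndF g)).length = 8 := length_gfields 8 _
  unfold geval
  rw [genv_eq, Polynomial.eval_add, Polynomial.eval_X, Polynomial.eval_C]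
  by_cases hw : WF Φ (gidx g) g.length (gfields 8 (sndF g))
  · have h1 := dle_all Φ ht hw
    have h2 : Φ.Lreq (gidx g) ≤ g.length := hw.1.2.2.2.2.2.2.2.2.1
    unfold SuccIntMatrixFamily.dmax at h1; unfold SuccIntMatrixFamily.Lreq SuccIntMatrixFamily.Fb at h2
    omega
  · rw [depth_of_not_wf Φ ht hw]; exact Nat.zero_le _

/-- ★ **The succinct kernel-vector circuit of the matrix family `Φ`.** Gates named by padded tuples
`[tag, s, f1, …, f6]` of the `n`-th circuit (31 tags: the entries of `A_n` split by sign, `AᵀA`,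
the reindexed all-coefficients Mahajan–Vinay matrix and its `2^t`-th powers, the coefficients of
`χ_{AᵀA}`, binary powers, `q_B(B)B^j` by selects on sums of squares, the kernel matrix and the
least nonzero column); every syntax map polynomial time on names. [cite: KoiranPerifel2009VPSPACE, §3.2, Prop. 1; MahajanVinay1999, Thm. 3.2; BorodinVonzurgathenHopcroft1982, §5 (NULLSPACE); KumarVolk2022, §6 (proof of Cor. 1.3)] -/
def kvc : SuccCircuit where
  kind := geval Φ.params 8 kindX
  width := geval Φ.params 8 widthX
  cbit := cbitF Φ
  arity := geval Φ.params 8 arityX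
  child := gchild Φ.params 8 childX
  depth := geval Φ.params 8 depthX
  dpoly := Polynomial.X + Polynomial.C 22
  kind_fp := codeFP_geval Φ.params_fp 8 kindX
  width_fp := codeFP_geval Φ.params_fp 8 widthX
  cbit_fp := codeFP_cbitF Φ
  arity_fp := codeFP_geval Φ.params_fp 8 arityX
  child_fp := codeFP_gchild Φ.params_fp 8 childX
  depth_child := kvc_depth_child Φ
  length_child := fun _ _ _ => (length_gchild _ _ _ _ _).le
  depth_le := kvc_depth_le Φ

/-- The circuit's fields, unfolded. [cite: KoiranPerifel2009VPSPACE, §3.2 (Uniform VPAR⁰: the syntax of a gate as a polynomial-time function of its name)] -/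
theorem kvc_kind (g : List Bool) : (kvc Φ).kind g = geval Φ.params 8 kindX g := rfl
/-- `kvc_width` (plumbing). [cite: KoiranPerifel2009VPSPACE, §3.2 (Uniform VPAR⁰: the syntax of a gate as a polynomial-time function of its name)] -/
theorem kvc_width (g : List Bool) : (kvc Φ).width g = geval Φ.params 8 widthX g := rfl
/-- `kvc_arity` (plumbing). [cite: KoiranPerifel2009VPSPACE, §3.2 (Uniform VPAR⁰: the syntax of a gate as a polynomial-time function of its name)] -/
theorem kvc_arity (g : List Bool) : (kvc Φ).arity g = geval Φ.params 8 arityX g := rfl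
/-- `kvc_child` (plumbing). [cite: KoiranPerifel2009VPSPACE, §3.2 (Uniform VPAR⁰: the syntax of a gate as a polynomial-time function of its name)] -/
theorem kvc_child (g : List Bool) (k : ℕ) : (kvc Φ).child g k = gchild Φ.params 8 childX g k := rfl
/-- `kvc_depth` (plumbing). [cite: KoiranPerifel2009VPSPACE, §3.2 (Uniform VPAR⁰: the syntax of a gate as a polynomial-time function of its name)] -/
theorem kvc_depth (g : List Bool) : (kvc Φ).depth g = geval Φ.params 8 depthX g := rfl
/-- `kvc_cbit` (plumbing). [cite: KoiranPerifel2009VPSPACE, §3.2 (Uniform VPAR⁰: the syntax of a gate as a polynomial-time function of its name)] -/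
theorem kvc_cbit (g : List Bool) (i : ℕ) : (kvc Φ).cbit g i = cbitF Φ g i := rfl

end Circuit

end KVC

end Literature.Computability.Complexity

end
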